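import Literature.NumberTheory.QuadraticFields.ChowlaCentralFactorial
import Literature.NumberTheory.QuadraticFields.RealQuadraticUnits
import Literature.NumberTheory.Transcendental.GammaMonomialsLValue
import HarnessLib

/-!
# Proof of Chowla's congruence `((p−1)/2)! ≡ (−1)^{(h+1)/2}·t/2 (mod p)`

Discharge of the named fact
`Literature.NumberTheory.QuadraticFields.chowla_central_factorial_congruence`
(`ChowlaCentralFactorial.lean`; Chowla 1961, Kiselev 1948):
`theorem chowla_central_factorial_congruence_holds`. Everything here is PROVED (theorems only, no
definitions, no named facts); the helpers live in the namespace
`Literature.NumberTheory.QuadraticFields.ChowlaProof`.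

## The argument (Chowla 1961; Urbanowicz–Williams, *Congruences for L-Functions*, Ch. II §1.1,
Theorem 9 and its proof)

Let `p ≡ 1 (mod 4)` be prime, `m = (p−1)/2` (even), `χ = (·/p)` (`jacobiChar p`, i.e. Mathlib's
`quadraticChar (ZMod p)`), `ζ = e^{2πi/p}`, `τ = ∑ χ(j) ζ^j` the Gauss sum (`τ² = p`),
`N = ∏_{χ(b) = −1} (1 − ζ^b)`, `Q = ∏_{χ(a) = 1} (1 − ζ^a)`, `K` quadratic of discriminant `p` with
class number `h`, and `ε₀ = (t + u√p)/2` for the least solution `(t, u)` of `t² + 4 = pu²`.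

1. (analysis, §E) `τ · L(1, χ) = −∑_j χ(j) log(1 − ζ^j)` (U–W Ch. I §5.1 (13)–(14)) from Mathlib's
   `ZMod.LFunction_dft`, the Fourier transform of a primitive character
   (`IsPrimitive.fourierTransform_eq_inv_mul_gaussSum`) and the boundary value
   `expZeta a 1 = −log(1 − e(a))` (`Transcendental/GammaMonomialsLValue.lean`); taking real parts,
   `∑ χ(j) log|1 − ζ^j| = log Q − log N = −τ·L(1, χ)`; `N`, `Q` are positive reals (pair `b` with
   `−b`, `−1` being a residue) with `NQ = Φ_p(1) = p`.
2. (units, §F) `L(1, χ) = 2 h log ε₀ / √p` (U–W Ch. I §8.2 (18)): the tree's analytic class number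
   formula `Quadratic.LFunction_jacobiChar_one_eq_of_discr_pos` with `w_K = 2` and `R_K = log ε₀`
   (`Quadratic.regulator_eq_log_of_minimal`, applied to the unit `(t − ut₁)/2 + uω` of norm `−1`;
   the minimality of `ε₀` among all `(X + Y√p)/2` with `X² − pY² = ±4`, `X, Y ≥ 1`, is reduced to
   the minimality of `t` by the descent `η ↦ ε₀ η̄`).
3. Hence `N = τ ε₀^h` if `τ = √p`, and `−Q = τ ε₀^h` if `τ = −√p` — the sign of the Gauss sum is
   NOT needed: it cancels against the choice of `N` or `−Q`.
4. (algebra, §B–C) Transport to `𝓞 L`, `L = ℚ(ζ_p)` (an embedding `σ` with `σ(ζ) = e^{2πi/p}`,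
   Mathlib `embeddingsEquivPrimitiveRoots`), `λ = 1 − ζ`: `m!·τ ≡ −λ^m (mod λ^{m+1})` (binomial
   expansion of `ζ^j = (1 + (ζ−1))^j`, Euler's criterion `χ(j) ≡ j^m` and the power sums over
   `𝔽_p`; this is U–W's `√p ≡ m!(1−ζ)^m`), `N = λ^m G` with `G ≡ ∏_{NR} b ≡ 1`, `−Q = λ^m G'` with
   `G' ≡ −∏_{QR} a ≡ 1` (`∏_{QR} a ≡ −1` by pairing `a ↔ a⁻¹`, and Wilson), `2ε₀ ≡ t (mod λ)`;
   cancelling `λ^m` in `2^h m!·P = m!·τ·(2ε₀)^h` gives `2^h m! + t^h ∈ (λ) ∩ ℤ = pℤ` (`λ` is a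
   non-unit dividing `p`: Mathlib `zeta_sub_one_prime'`).
5. (ℤ, final step) With `t² ≡ −4` and `(m!)² ≡ −1 (mod p)`: `h` is necessarily odd and
   `2·m! ≡ (−1)^{(h+1)/2} t (mod p)`.

## References

* [Chowla1961] S. Chowla, *On the class number of real quadratic fields*, Proc. Nat. Acad. Sci.
  USA 47 (1961), 878 (doi:10.1073/pnas.47.6.878; not held — read through the secondary source below).
* [UrbanowiczWilliams2000] J. Urbanowicz, K. S. Williams, *Congruences for L-Functions*, Kluwer
  (2000): Ch. I §5.1 (13)–(14) (PDF p. 20), §8.2 (18) (p. 28); Ch. II §1.1 Theorem 9 ([Chowla 1961])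
  with its proof (pp. 43–44) (held: `book:urbanowicznd-congruences-l-functions`).
* [Mordell1961] L. J. Mordell, *The congruence ((p−1)/2)! ≡ ±1 (mod p)*, Amer. Math. Monthly 68
  (1961), 145–146 (the companion case `p ≡ 3 (mod 4)`).
-/

noncomputable section

open Finset Polynomial

namespace Literature.NumberTheory.QuadraticFields.ChowlaProof

variable {p : ℕ} [hp : Fact p.Prime]

/-! ### Elementary facts about `p`, `m = p / 2` -/

/-- `2·(p/2) + 1 = p` for an odd prime `p` (so `m = p/2 = (p-1)/2`). [folklore] -/
theorem two_mul_half_add_one (hp2 : p ≠ 2) : 2 * (p / 2) + 1 = p := by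
  have hodd : p % 2 = 1 := Nat.odd_iff.mp (hp.out.odd_of_ne_two hp2)
  omega

/-- `ZMod p` has characteristic `≠ 2` when `p ≠ 2`. [folklore] -/
theorem ringChar_ne_two (hp2 : p ≠ 2) : ringChar (ZMod p) ≠ 2 := by
  rwa [ZMod.ringChar_zmod_n]

/-! ### Power sums in `ZMod p` -/

/-- Power sums over `𝔽_p`: `∑_x x^i = 0` for `i < p - 1` (Mathlib `FiniteField.sum_pow_lt_card_sub_one`).
[folklore] -/
theorem sum_pow_eq_zero_of_lt {i : ℕ} (hi : i < p - 1) : ∑ x : ZMod p, x ^ i = 0 := by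
  have h := FiniteField.sum_pow_lt_card_sub_one (K := ZMod p) i (by rwa [ZMod.card])
  exact h

/-- Power sums over `𝔽_p`: `∑_x x^{p-1} = p - 1 = -1`. [folklore] -/
theorem sum_pow_card_sub_one : ∑ x : ZMod p, x ^ (p - 1) = -1 := by
  classical
  have h2 := hp.out.two_le
  have hsplit : ∑ x : ZMod p, x ^ (p - 1) = ∑ x ∈ univ \ {(0 : ZMod p)}, x ^ (p - 1) := by
    rw [← sum_sdiff ({0} : Finset (ZMod p)).subset_univ, sum_singleton,
      zero_pow (by omega), add_zero]
  have hunits : ∑ x ∈ univ \ {(0 : ZMod p)}, x ^ (p - 1) =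
      ∑ x : (ZMod p)ˣ, ((x : ZMod p) ^ (p - 1)) := by
    let φ : (ZMod p)ˣ ↪ ZMod p := ⟨fun x ↦ x, Units.val_injective⟩
    have hmap : univ.map φ = univ \ {0} := by
      ext x
      simp only [mem_map, mem_univ, Function.Embedding.coeFn_mk, true_and, mem_sdiff,
        mem_singleton, φ]
      constructor
      · rintro ⟨u, rfl⟩
        exact u.ne_zero
      · intro hx
        exact ⟨Units.mk0 x hx, rfl⟩
    rw [← hmap, sum_map]
    rfl
  rw [hsplit, hunits, FiniteField.sum_pow_units (ZMod p) (p - 1), ZMod.card, if_pos dvd_rfl]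

/-! ### The character sums `d_i = ∑_j χ(j) · j(j-1)⋯(j-i+1)` modulo `p` -/

/-- For `i ≤ m = (p-1)/2`: `∑_{j mod p} χ(j) j^{(i)} ≡ -1` if `i = m` and `≡ 0` if `i < m`, where
`j^{(i)}` is the falling factorial (Euler's criterion `χ(j) ≡ j^m` and the power sums).
[folklore] -/
theorem charsum_descFactorial_cast (hp2 : p ≠ 2) {i : ℕ} (hi : i ≤ p / 2) :
    ((∑ j : ZMod p, quadraticChar (ZMod p) j * (j.val.descFactorial i : ℤ) : ℤ) : ZMod p) =
      if i = p / 2 then -1 else 0 := by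
  have hp' := two_mul_half_add_one hp2
  have hchar := ringChar_ne_two hp2
  set f : (ZMod p)[X] := descPochhammer (ZMod p) i with hf
  have hf_monic : f.Monic := monic_descPochhammer (ZMod p) i
  have hf_deg : f.natDegree = i := descPochhammer_natDegree (ZMod p) i
  have hterm : ∀ j : ZMod p,
      (((quadraticChar (ZMod p) j * (j.val.descFactorial i : ℤ) : ℤ)) : ZMod p) =
        ∑ k ∈ range (i + 1), f.coeff k * j ^ (p / 2 + k) := by
    intro j
    have h1 : ((quadraticChar (ZMod p) j : ℤ) : ZMod p) = j ^ (p / 2) := by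
      rw [quadraticChar_eq_pow_of_char_ne_two' hchar j, ZMod.card]
    have h2 : (((j.val.descFactorial i : ℕ) : ℤ) : ZMod p) = f.eval j := by
      rw [Int.cast_natCast, hf, ← ZMod.natCast_zmod_val j, descPochhammer_eval_eq_descFactorial,
        ZMod.natCast_zmod_val]
    rw [Int.cast_mul, h1, h2, Polynomial.eval_eq_sum_range, hf_deg, Finset.mul_sum]
    refine Finset.sum_congr rfl fun k _ => ?_
    rw [pow_add]
    ring
  rw [Int.cast_sum]
  simp_rw [hterm]
  rw [Finset.sum_comm]
  simp_rw [← Finset.mul_sum]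
  rw [Finset.sum_range_succ]
  have hvanish : ∑ k ∈ range i, f.coeff k * ∑ j : ZMod p, j ^ (p / 2 + k) = 0 := by
    refine Finset.sum_eq_zero fun k hk => ?_
    rw [Finset.mem_range] at hk
    rw [sum_pow_eq_zero_of_lt (by omega), mul_zero]
  rw [hvanish, zero_add]
  split_ifs with him
  · rw [him, show p / 2 + p / 2 = p - 1 by omega, sum_pow_card_sub_one]
    have : f.coeff (p / 2) = 1 := by
      have := hf_monic.coeff_natDegree
      rwa [hf_deg, him] at this
    rw [this, one_mul]
  · rw [sum_pow_eq_zero_of_lt (by omega), mul_zero]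

/-- Integer form: `p ∣ d_i` for `i < m`. [folklore] -/
theorem dvd_charsum_descFactorial_of_lt (hp2 : p ≠ 2) {i : ℕ} (hi : i < p / 2) :
    (p : ℤ) ∣ ∑ j : ZMod p, quadraticChar (ZMod p) j * (j.val.descFactorial i : ℤ) := by
  rw [← ZMod.intCast_zmod_eq_zero_iff_dvd, charsum_descFactorial_cast hp2 hi.le, if_neg hi.ne]

/-- Integer form: `p ∣ d_m + 1`. [folklore] -/
theorem dvd_charsum_descFactorial_half_add_one (hp2 : p ≠ 2) :
    (p : ℤ) ∣ (∑ j : ZMod p, quadraticChar (ZMod p) j * (j.val.descFactorial (p / 2) : ℤ)) + 1 := by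
  rw [← ZMod.intCast_zmod_eq_zero_iff_dvd, Int.cast_add, charsum_descFactorial_cast hp2 le_rfl,
    if_pos rfl, Int.cast_one, neg_add_cancel]

/-! ### The `λ`-adic expansion of the Gauss sum `∑ χ(j) ζ^j` (`λ = ζ - 1`) -/

/-- `m! (λ+1)^n ≡ ∑_{i ≤ m} (m!/i!) n^{(i)} λ^i (mod λ^{m+1})`. [folklore] -/
theorem factorial_mul_add_one_pow_sub_mem {A : Type*} [CommRing A] (lam : A) (n m : ℕ) :
    (m.factorial : A) * (lam + 1) ^ n -
        ∑ i ∈ range (m + 1), ((m.factorial / i.factorial * n.descFactorial i : ℕ) : A) * lam ^ i ∈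
      Ideal.span {lam ^ (m + 1)} := by
  set I : Ideal A := Ideal.span {lam ^ (m + 1)} with hI
  -- `F i = m! C(n,i) λ^i`
  set F : ℕ → A := fun i => ((m.factorial * n.choose i : ℕ) : A) * lam ^ i with hF
  have hexp : (m.factorial : A) * (lam + 1) ^ n = ∑ i ∈ range (n + 1), F i := by
    rw [add_pow, Finset.mul_sum]
    refine Finset.sum_congr rfl fun i _ => ?_
    rw [hF]
    push_cast
    ring
  -- extend the range to `m + 1 + n`
  have hext : ∑ i ∈ range (n + 1), F i = ∑ i ∈ range (m + 1 + n), F i := by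
    apply Finset.sum_subset (Finset.range_subset_range.mpr (by omega))
    intro i hi hi'
    rw [Finset.mem_range] at hi hi'
    rw [hF]
    simp only
    rw [Nat.choose_eq_zero_of_lt (by omega), mul_zero, Nat.cast_zero, zero_mul]
  rw [hexp, hext, Finset.sum_range_add]
  -- the first block agrees termwise, the second block lies in `I`
  have hfirst : ∑ i ∈ range (m + 1), F i =
      ∑ i ∈ range (m + 1), ((m.factorial / i.factorial * n.descFactorial i : ℕ) : A) * lam ^ i := by
    refine Finset.sum_congr rfl fun i hi => ?_
    rw [Finset.mem_range] at hi
    rw [hF]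
    simp only
    congr 2
    rw [Nat.descFactorial_eq_factorial_mul_choose, ← mul_assoc,
      Nat.div_mul_cancel (Nat.factorial_dvd_factorial (by omega))]
  rw [hfirst, add_sub_cancel_left]
  refine Ideal.sum_mem _ fun i _ => ?_
  rw [hF]
  simp only
  rw [show lam ^ (m + 1 + i) = lam ^ (m + 1) * lam ^ i by rw [pow_add]]
  exact Ideal.mul_mem_left _ _ (Ideal.mul_mem_right _ _ (Ideal.subset_span rfl))

/-- **The Gauss sum modulo `λ^{m+1}`**: if `p ∈ (λ^{m+1})` (`λ = ζ - 1`, `m = (p-1)/2`) then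
`m! · ∑_j χ(j) ζ^j ≡ -λ^m (mod λ^{m+1})`.
[cite: UrbanowiczWilliams2000, Ch. II §1.1 Thm 9 (proof)] -/
theorem factorial_mul_gaussSum_add_mem (hp2 : p ≠ 2) {A : Type*} [CommRing A] (ζ : A)
    (hpmem : (p : A) ∈ Ideal.span {(ζ - 1) ^ (p / 2 + 1)}) :
    ((p / 2).factorial : A) * (∑ j : ZMod p, (quadraticChar (ZMod p) j : A) * ζ ^ j.val) +
        (ζ - 1) ^ (p / 2) ∈ Ideal.span {(ζ - 1) ^ (p / 2 + 1)} := by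
  set m := p / 2 with hm
  set lam := ζ - 1 with hlam
  set I : Ideal A := Ideal.span {lam ^ (m + 1)} with hI
  have hζ : ζ = lam + 1 := by rw [hlam]; ring
  -- Step 1: replace each `m! ζ^{j}` by the truncated expansion.
  set T : ZMod p → A := fun j =>
    ∑ i ∈ range (m + 1), ((m.factorial / i.factorial * j.val.descFactorial i : ℕ) : A) * lam ^ i
    with hT
  have hstep1 : (m.factorial : A) * (∑ j : ZMod p, (quadraticChar (ZMod p) j : A) * ζ ^ j.val) -
      ∑ j : ZMod p, (quadraticChar (ZMod p) j : A) * T j ∈ I := by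
    rw [Finset.mul_sum, ← Finset.sum_sub_distrib]
    refine Ideal.sum_mem _ fun j _ => ?_
    have := factorial_mul_add_one_pow_sub_mem lam j.val m
    rw [← hζ] at this
    have h := Ideal.mul_mem_left I ((quadraticChar (ZMod p) j : A)) this
    convert h using 1
    rw [hT]
    ring
  -- Step 2: swap the sums: `∑_j χ(j) T j = ∑_{i ≤ m} (m!/i!) d_i λ^i`.
  have hstep2 : ∑ j : ZMod p, (quadraticChar (ZMod p) j : A) * T j =
      ∑ i ∈ range (m + 1), ((m.factorial / i.factorial : ℕ) : A) *
        ((∑ j : ZMod p, quadraticChar (ZMod p) j * (j.val.descFactorial i : ℤ) : ℤ) : A) * lam ^ i := by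
    simp only [hT, Finset.mul_sum]
    rw [Finset.sum_comm]
    refine Finset.sum_congr rfl fun i _ => ?_
    push_cast
    rw [Finset.mul_sum, Finset.sum_mul]
    refine Finset.sum_congr rfl fun j _ => ?_
    ring
  -- Step 3: all terms with `i < m` are `≡ 0`, the term `i = m` is `≡ -λ^m`.
  have hpI : (p : A) ∈ I := hpmem
  have hstep3 : ∑ i ∈ range (m + 1), ((m.factorial / i.factorial : ℕ) : A) *
        ((∑ j : ZMod p, quadraticChar (ZMod p) j * (j.val.descFactorial i : ℤ) : ℤ) : A) * lam ^ i +
      lam ^ m ∈ I := by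
    rw [Finset.sum_range_succ, Nat.div_self (Nat.factorial_pos m), Nat.cast_one, one_mul]
    obtain ⟨c, hc⟩ := dvd_charsum_descFactorial_half_add_one (p := p) hp2
    have hlast : ((∑ j : ZMod p, quadraticChar (ZMod p) j * (j.val.descFactorial m : ℤ) : ℤ) : A) *
        lam ^ m + lam ^ m = (p : A) * ((c : A) * lam ^ m) := by
      have : ((∑ j : ZMod p, quadraticChar (ZMod p) j * (j.val.descFactorial m : ℤ) : ℤ) : A) =
          (p : A) * (c : A) - 1 := by
        have h' := congrArg (fun z : ℤ => (z : A)) hc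
        simp only [Int.cast_add, Int.cast_one, Int.cast_mul, Int.cast_natCast] at h'
        linear_combination h'
      rw [this]
      ring
    rw [add_assoc, hlast]
    refine I.add_mem (Ideal.sum_mem _ fun i hi => ?_) (I.mul_mem_right _ hpI)
    rw [Finset.mem_range] at hi
    obtain ⟨c', hc'⟩ := dvd_charsum_descFactorial_of_lt (p := p) hp2 hi
    rw [hc']
    push_cast
    rw [show ((m.factorial / i.factorial : ℕ) : A) * ((p : A) * (c' : A)) * lam ^ i =
      (p : A) * (((m.factorial / i.factorial : ℕ) : A) * (c' : A) * lam ^ i) by ring]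
    exact I.mul_mem_right _ hpI
  have := I.add_mem hstep1 hstep3
  rw [hstep2] at this
  convert this using 1
  ring

/-! ### Geometric sums: `ζ^n - 1 = (ζ - 1)(1 + ζ + ⋯ + ζ^{n-1})`, `1 + ⋯ + ζ^{n-1} ≡ n (mod ζ - 1)` -/

/-- `1 + ζ + ⋯ + ζ^{n-1} ≡ n (mod 1 - ζ)` in any commutative ring. [folklore] -/
theorem geom_sum_sub_natCast_mem {A : Type*} [CommRing A] (ζ : A) (n : ℕ) :
    (∑ i ∈ range n, ζ ^ i) - (n : A) ∈ Ideal.span {1 - ζ} := by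
  have : (∑ i ∈ range n, ζ ^ i) - (n : A) = ∑ i ∈ range n, (ζ ^ i - 1) := by
    rw [Finset.sum_sub_distrib, Finset.sum_const, Finset.card_range, nsmul_eq_mul, mul_one]
  rw [this]
  refine Ideal.sum_mem _ fun i _ => ?_
  rw [Ideal.mem_span_singleton]
  have h := sub_dvd_pow_sub_pow ζ 1 i
  rw [one_pow] at h
  rw [show (1 : A) - ζ = -(ζ - 1) by ring, neg_dvd]
  exact h

/-- `1 - ζ^n = (1 - ζ)(1 + ζ + ⋯ + ζ^{n-1})`. [folklore] -/
theorem one_sub_pow_eq_mul_geom_sum {A : Type*} [CommRing A] (ζ : A) (n : ℕ) :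
    1 - ζ ^ n = (1 - ζ) * ∑ i ∈ range n, ζ ^ i := by
  have := mul_geom_sum ζ n
  linear_combination this

/-- A product of factors `1 - ζ^{n_j}` over a finset: `∏ (1 - ζ^{n_j}) = (1-ζ)^{#s} · G` with
`G ≡ ∏ n_j (mod 1 - ζ)`. [folklore] -/
theorem prod_one_sub_pow_eq {A : Type*} [CommRing A] (ζ : A) {ι : Type*} (s : Finset ι) (n : ι → ℕ) :
    ∃ G : A, ∏ j ∈ s, (1 - ζ ^ n j) = (1 - ζ) ^ s.card * G ∧
      G - ((∏ j ∈ s, n j : ℕ) : A) ∈ Ideal.span {1 - ζ} := by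
  classical
  refine ⟨∏ j ∈ s, ∑ i ∈ range (n j), ζ ^ i, ?_, ?_⟩
  · rw [Finset.pow_card_mul_prod]
    exact Finset.prod_congr rfl fun j _ => one_sub_pow_eq_mul_geom_sum ζ (n j)
  · rw [← Ideal.Quotient.eq, map_prod, Nat.cast_prod, map_prod]
    refine Finset.prod_congr rfl fun j _ => ?_
    rw [Ideal.Quotient.eq]
    exact geom_sum_sub_natCast_mem ζ (n j)

/-! ### `∏_{j ≠ 0} (1 - ζ^j) = p` for a primitive `p`-th root of unity in a domain -/

/-- **`∏_{0<j<p} (1 - ζ^j) = Φ_p(1) = p`** for a primitive `p`-th root of unity `ζ` in a domain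
(`j ↦ ζ^j` is a bijection from the non-zero residues onto the primitive `p`-th roots). [folklore] -/
theorem prod_one_sub_pow_eq_prime {A : Type*} [CommRing A] [IsDomain A] {ζ : A}
    (hζ : IsPrimitiveRoot ζ p) :
    ∏ j ∈ (univ : Finset (ZMod p)).filter (· ≠ 0), (1 - ζ ^ j.val) = (p : A) := by
  classical
  have hp1 := hp.out.one_lt
  have hp0 := hp.out.pos
  -- the map `j ↦ ζ^{j}` is a bijection from `{j ≠ 0}` onto the primitive roots
  have himage : ((univ : Finset (ZMod p)).filter (· ≠ 0)).image (fun j => ζ ^ j.val) =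
      primitiveRoots p A := by
    ext μ
    simp only [Finset.mem_image, Finset.mem_filter, Finset.mem_univ, true_and,
      mem_primitiveRoots hp0]
    constructor
    · rintro ⟨j, hj, rfl⟩
      apply hζ.pow_of_coprime
      have hjv : j.val ≠ 0 := (ZMod.val_ne_zero j).mpr hj
      refine Nat.Coprime.symm ((Nat.Prime.coprime_iff_not_dvd hp.out).mpr fun hd => ?_)
      exact hjv (Nat.eq_zero_of_dvd_of_lt hd (ZMod.val_lt j))
    · intro hμ
      obtain ⟨i, hi, rfl⟩ := hζ.eq_pow_of_pow_eq_one hμ.pow_eq_one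
      refine ⟨(i : ZMod p), ?_, by rw [ZMod.val_natCast_of_lt hi]⟩
      intro h0
      rw [ZMod.natCast_eq_zero_iff] at h0
      have hi0 : i = 0 := Nat.eq_zero_of_dvd_of_lt h0 hi
      rw [hi0, pow_zero] at hμ
      exact hμ.ne_one hp1 rfl
  have hinj : ∀ x ∈ (univ : Finset (ZMod p)).filter (· ≠ 0),
      ∀ y ∈ (univ : Finset (ZMod p)).filter (· ≠ 0), ζ ^ x.val = ζ ^ y.val → x = y := by
    intro x _ y _ hxy
    exact ZMod.val_injective p (hζ.pow_inj (ZMod.val_lt x) (ZMod.val_lt y) hxy)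
  have h1 : ∏ j ∈ (univ : Finset (ZMod p)).filter (· ≠ 0), (1 - ζ ^ j.val) =
      ∏ μ ∈ ((univ : Finset (ZMod p)).filter (· ≠ 0)).image (fun j => ζ ^ j.val), (1 - μ) := by
    rw [Finset.prod_image hinj]
  rw [h1, himage]
  have h2 := Polynomial.eval_one_cyclotomic_prime (R := A) (p := p)
  rw [Polynomial.cyclotomic_eq_prod_X_sub_primitiveRoots hζ, Polynomial.eval_prod] at h2
  simp only [Polynomial.eval_sub, Polynomial.eval_X, Polynomial.eval_C] at h2
  exact h2

/-! ### Residues and non-residues: the half system, cardinalities, products -/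

/-- The non-zero residues mod `p` are the half system `{0 < j ≤ (p-1)/2}` together with its
negatives. [folklore] -/
theorem filter_ne_zero_eq_union_half (hp2 : p ≠ 2) :
    (univ : Finset (ZMod p)).filter (· ≠ 0) =
      univ.filter (fun j : ZMod p => j ≠ 0 ∧ j.val ≤ p / 2) ∪
        (univ.filter (fun j : ZMod p => j ≠ 0 ∧ j.val ≤ p / 2)).image Neg.neg := by
  have hp' := two_mul_half_add_one hp2
  ext j
  simp only [mem_filter, mem_univ, true_and, mem_union, mem_image]
  constructor
  · intro hj
    by_cases hv : j.val ≤ p / 2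
    · exact Or.inl ⟨hj, hv⟩
    · refine Or.inr ⟨-j, ⟨neg_ne_zero.mpr hj, ?_⟩, neg_neg j⟩
      rw [ZMod.neg_val, if_neg hj]
      have := ZMod.val_lt j
      omega
  · rintro (⟨hj, -⟩ | ⟨k, ⟨hk, -⟩, rfl⟩)
    · exact hj
    · exact neg_ne_zero.mpr hk

/-- The half system `{0 < j ≤ (p-1)/2}` and its set of negatives are disjoint (`p` odd). [folklore] -/
theorem disjoint_half_neg_half (hp2 : p ≠ 2) :
    Disjoint (univ.filter (fun j : ZMod p => j ≠ 0 ∧ j.val ≤ p / 2))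
      ((univ.filter (fun j : ZMod p => j ≠ 0 ∧ j.val ≤ p / 2)).image Neg.neg) := by
  have hp' := two_mul_half_add_one hp2
  rw [Finset.disjoint_left]
  intro j hj hj'
  simp only [mem_filter, mem_univ, true_and, mem_image] at hj hj'
  obtain ⟨k, ⟨hk0, hk⟩, rfl⟩ := hj'
  rw [ZMod.neg_val, if_neg hk0] at hj
  have := ZMod.val_lt k
  have hkpos : 0 < k.val := Nat.pos_of_ne_zero ((ZMod.val_ne_zero k).mpr hk0)
  omega

/-- **Pairing `j` with `-j`.** A product over the non-zero residues is a product over the half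
system `0 < j ≤ (p-1)/2` of `f(j) f(-j)`. [folklore] -/
theorem prod_filter_ne_zero_eq_prod_half (hp2 : p ≠ 2) {M : Type*} [CommMonoid M]
    (f : ZMod p → M) :
    ∏ j ∈ (univ : Finset (ZMod p)).filter (· ≠ 0), f j =
      ∏ j ∈ univ.filter (fun j : ZMod p => j ≠ 0 ∧ j.val ≤ p / 2), (f j * f (-j)) := by
  rw [filter_ne_zero_eq_union_half hp2, Finset.prod_union (disjoint_half_neg_half hp2),
    Finset.prod_image (fun x _ y _ h => neg_injective h), Finset.prod_mul_distrib]

/-- The same for a product over `{j ≠ 0 | P j}` with `P` symmetric under `j ↦ -j`. [folklore] -/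
theorem prod_filter_eq_prod_half (hp2 : p ≠ 2) {M : Type*} [CommMonoid M] (f : ZMod p → M)
    (P : ZMod p → Prop) [DecidablePred P] (hP : ∀ j, P (-j) ↔ P j) :
    ∏ j ∈ (univ : Finset (ZMod p)).filter (fun j => j ≠ 0 ∧ P j), f j =
      ∏ j ∈ univ.filter (fun j : ZMod p => (j ≠ 0 ∧ j.val ≤ p / 2) ∧ P j), (f j * f (-j)) := by
  classical
  have hL : ∏ j ∈ (univ : Finset (ZMod p)).filter (fun j => j ≠ 0 ∧ P j), f j =
      ∏ j ∈ (univ : Finset (ZMod p)).filter (· ≠ 0), (if P j then f j else 1) := by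
    rw [Finset.prod_filter, Finset.prod_filter]
    refine Finset.prod_congr rfl fun j _ => ?_
    by_cases h0 : j = 0 <;> by_cases hPj : P j <;> simp [h0, hPj]
  have hR : ∏ j ∈ univ.filter (fun j : ZMod p => (j ≠ 0 ∧ j.val ≤ p / 2) ∧ P j), (f j * f (-j)) =
      ∏ j ∈ univ.filter (fun j : ZMod p => j ≠ 0 ∧ j.val ≤ p / 2),
        ((if P j then f j else 1) * (if P (-j) then f (-j) else 1)) := by
    rw [Finset.prod_filter, Finset.prod_filter]
    refine Finset.prod_congr rfl fun j _ => ?_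
    by_cases h0 : (j ≠ 0 ∧ j.val ≤ p / 2) <;> by_cases hPj : P j <;> simp [h0, hPj, hP j]
  rw [hL, hR, prod_filter_ne_zero_eq_prod_half hp2]

/-- `χ(-j) = χ(j)` when `p ≡ 1 (mod 4)`. [folklore] -/
theorem quadraticChar_neg_eq (hp1 : p % 4 = 1) (j : ZMod p) :
    quadraticChar (ZMod p) (-j) = quadraticChar (ZMod p) j := by
  have hp2 : p ≠ 2 := by rintro rfl; norm_num at hp1
  rw [← neg_one_mul, map_mul, quadraticChar_neg_one (ringChar_ne_two hp2), ZMod.card,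
    ZMod.χ₄_nat_one_mod_four hp1, one_mul]

/-- `χ(0) = 0`, so `χ(j) = 1` forces `j ≠ 0`. [folklore] -/
theorem ne_zero_of_quadraticChar_eq {j : ZMod p} {c : ℤ} (hc : c ≠ 0)
    (h : quadraticChar (ZMod p) j = c) : j ≠ 0 := by
  rintro rfl
  rw [quadraticChar_zero] at h
  exact hc h.symm

/-- The non-zero residues mod `p` are the quadratic residues together with the non-residues.
[folklore] -/
theorem filter_ne_zero_eq_qr_union_nr :
    (univ : Finset (ZMod p)).filter (· ≠ 0) =
      univ.filter (fun j : ZMod p => quadraticChar (ZMod p) j = 1) ∪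
        univ.filter (fun j : ZMod p => quadraticChar (ZMod p) j = -1) := by
  ext j
  simp only [mem_filter, mem_univ, true_and, mem_union]
  constructor
  · intro hj
    exact quadraticChar_dichotomy hj
  · rintro (h | h)
    · exact ne_zero_of_quadraticChar_eq one_ne_zero h
    · exact ne_zero_of_quadraticChar_eq (by norm_num) h

/-- Quadratic residues and non-residues are disjoint. [folklore] -/
theorem disjoint_qr_nr :
    Disjoint (univ.filter (fun j : ZMod p => quadraticChar (ZMod p) j = 1))
      (univ.filter (fun j : ZMod p => quadraticChar (ZMod p) j = -1)) := by
  rw [Finset.disjoint_left]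
  intro j hj hj'
  simp only [mem_filter, mem_univ, true_and] at hj hj'
  rw [hj] at hj'
  norm_num at hj'

/-- `#QR = #NR = (p-1)/2`. [folklore] -/
theorem card_qr_and_card_nr (hp2 : p ≠ 2) :
    (univ.filter (fun j : ZMod p => quadraticChar (ZMod p) j = 1)).card = p / 2 ∧
      (univ.filter (fun j : ZMod p => quadraticChar (ZMod p) j = -1)).card = p / 2 := by
  have hp' := two_mul_half_add_one hp2
  have hchar := ringChar_ne_two hp2
  -- `#QR - #NR = ∑ χ = 0`
  have hdiff : ((univ.filter (fun j : ZMod p => quadraticChar (ZMod p) j = 1)).card : ℤ) -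
      (univ.filter (fun j : ZMod p => quadraticChar (ZMod p) j = -1)).card = 0 := by
    rw [Finset.card_filter, Finset.card_filter, Nat.cast_sum, Nat.cast_sum, ← Finset.sum_sub_distrib,
      ← quadraticChar_sum_zero hchar]
    refine Finset.sum_congr rfl fun j _ => ?_
    rcases quadraticChar_isQuadratic (ZMod p) j with h | h | h <;> simp [h]
  -- `#QR + #NR + 1 = p`
  have hsum : (univ.filter (fun j : ZMod p => quadraticChar (ZMod p) j = 1)).card +
      (univ.filter (fun j : ZMod p => quadraticChar (ZMod p) j = -1)).card + 1 = p := by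
    have h1 : (univ.filter (fun j : ZMod p => j = 0)).card = 1 := by
      rw [Finset.filter_eq', if_pos (Finset.mem_univ _), Finset.card_singleton]
    rw [← h1, Finset.card_filter, Finset.card_filter, Finset.card_filter, ← Finset.sum_add_distrib,
      ← Finset.sum_add_distrib]
    conv_rhs => rw [← ZMod.card p, ← Finset.card_univ, Finset.card_eq_sum_ones]
    refine Finset.sum_congr rfl fun j _ => ?_
    by_cases hj : j = 0
    · subst hj
      simp
    · rcases quadraticChar_dichotomy hj with h | h <;> simp [h, hj]
  constructor <;> omega

/-- **Wilson**: `∏_{j ≠ 0} j = -1` in `ZMod p`. [folklore] -/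
theorem prod_filter_ne_zero_id : ∏ j ∈ (univ : Finset (ZMod p)).filter (· ≠ 0), j = -1 := by
  classical
  let φ : (ZMod p)ˣ ↪ ZMod p := ⟨fun x ↦ x, Units.val_injective⟩
  have hmap : univ.map φ = univ.filter (· ≠ 0) := by
    ext x
    simp only [mem_map, mem_univ, Function.Embedding.coeFn_mk, true_and, mem_filter, φ]
    constructor
    · rintro ⟨u, rfl⟩
      exact u.ne_zero
    · intro hx
      exact ⟨Units.mk0 x hx, rfl⟩
  rw [← hmap, Finset.prod_map]
  have h := FiniteField.prod_univ_units_id_eq_neg_one (K := ZMod p)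
  have h' := congrArg (fun u : (ZMod p)ˣ => (u : ZMod p)) h
  simp only [Units.coe_prod, Units.val_neg, Units.val_one] at h'
  exact h'

/-- `∏_{QR} j = -1` for `p ≡ 1 (mod 4)`: pair `j` with `j⁻¹`; the fixed points are `±1`, both
residues. [folklore] -/
theorem prod_qr_id (hp1 : p % 4 = 1) :
    ∏ j ∈ univ.filter (fun j : ZMod p => quadraticChar (ZMod p) j = 1), j = -1 := by
  classical
  have hp2 : p ≠ 2 := by rintro rfl; norm_num at hp1
  have hchar := ringChar_ne_two hp2
  set QR := univ.filter (fun j : ZMod p => quadraticChar (ZMod p) j = 1) with hQR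
  have hmem : ∀ j, j ∈ QR ↔ quadraticChar (ZMod p) j = 1 := fun j => by simp [hQR]
  have h1 : (1 : ZMod p) ∈ QR := (hmem 1).mpr (by rw [map_one])
  have hm1 : (-1 : ZMod p) ∈ QR := (hmem (-1)).mpr (by
    rw [quadraticChar_neg_one hchar, ZMod.card, ZMod.χ₄_nat_one_mod_four hp1])
  have hne : (-1 : ZMod p) ≠ 1 := Ring.neg_one_ne_one_of_char_ne_two hchar
  have hm1' : (-1 : ZMod p) ∈ QR.erase 1 := Finset.mem_erase.mpr ⟨hne, hm1⟩
  -- the product over `QR \ {1, -1}` is `1`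
  have hinv : ∏ j ∈ (QR.erase 1).erase (-1), j = 1 := by
    refine Finset.prod_involution (fun a _ => a⁻¹) ?_ ?_ ?_ ?_
    · intro a ha
      simp only [Finset.mem_erase, hmem] at ha
      exact mul_inv_cancel₀ (ne_zero_of_quadraticChar_eq one_ne_zero ha.2.2)
    · intro a ha _
      simp only [Finset.mem_erase, hmem] at ha
      intro h
      have ha0 : a ≠ 0 := ne_zero_of_quadraticChar_eq one_ne_zero ha.2.2
      have : a * a = 1 := by
        calc a * a = a * a⁻¹ := by rw [h]
          _ = 1 := mul_inv_cancel₀ ha0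
      rcases mul_self_eq_one_iff.mp this with h' | h'
      · exact ha.2.1 h'
      · exact ha.1 h'
    · intro a ha
      simp only [Finset.mem_erase, hmem] at ha ⊢
      have ha0 : a ≠ 0 := ne_zero_of_quadraticChar_eq one_ne_zero ha.2.2
      refine ⟨fun h => ha.1 (by rw [← inv_inv a, h, inv_neg, inv_one]),
        fun h => ha.2.1 (by rw [← inv_inv a, h, inv_one]), ?_⟩
      have : a⁻¹ = a * (a⁻¹) ^ 2 := by field_simp
      rw [this, map_mul, quadraticChar_sq_one' (inv_ne_zero ha0), ha.2.2, mul_one]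
    · intro a _
      exact inv_inv a
  have e1 : ∏ j ∈ QR, j = 1 * ∏ j ∈ QR.erase 1, j :=
    (Finset.mul_prod_erase QR (fun j => j) h1).symm
  have e2 : ∏ j ∈ QR.erase 1, j = (-1) * ∏ j ∈ (QR.erase 1).erase (-1), j :=
    (Finset.mul_prod_erase (QR.erase 1) (fun j => j) hm1').symm
  rw [e1, e2, hinv]
  ring

/-- `∏_{NR} j = 1` for `p ≡ 1 (mod 4)`. [folklore] -/
theorem prod_nr_id (hp1 : p % 4 = 1) :
    ∏ j ∈ univ.filter (fun j : ZMod p => quadraticChar (ZMod p) j = -1), j = 1 := by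
  have h := prod_filter_ne_zero_id (p := p)
  rw [filter_ne_zero_eq_qr_union_nr, Finset.prod_union disjoint_qr_nr, prod_qr_id hp1] at h
  have : (-1 : ZMod p) * (∏ j ∈ univ.filter (fun j : ZMod p => quadraticChar (ZMod p) j = -1), j) *
      (-1) = -1 * -1 := by rw [h]
  simpa using this

/-- `((p-1)/2)!² ≡ -1 (mod p)` for `p ≡ 1 (mod 4)`. [folklore] -/
theorem factorial_half_sq (hp1 : p % 4 = 1) : (((p / 2).factorial : ℕ) : ZMod p) ^ 2 = -1 := by
  set m := p / 2 with hm
  have hpm : p - 1 = m + m := by omega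
  have hmeven : Even m := ⟨p / 4, by omega⟩
  have hw := ZMod.wilsons_lemma (p := p)
  rw [hpm, ← Finset.prod_range_add_one_eq_factorial, Nat.cast_prod, Finset.prod_range_add] at hw
  have hrefl : ∏ x ∈ range m, (((m + x + 1 : ℕ)) : ZMod p) =
      (-1) ^ m * ∏ x ∈ range m, ((x + 1 : ℕ) : ZMod p) := by
    have h1 : ∀ x ∈ range m, (((m + x + 1 : ℕ)) : ZMod p) =
        (-1) * (((m - 1 - x) + 1 : ℕ) : ZMod p) := by
      intro x hx
      rw [Finset.mem_range] at hx
      rw [neg_one_mul, eq_neg_iff_add_eq_zero, ← Nat.cast_add,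
        show m + x + 1 + (m - 1 - x + 1) = p by omega, ZMod.natCast_self]
    rw [Finset.prod_congr rfl h1, Finset.prod_mul_distrib, Finset.prod_const, Finset.card_range,
      Finset.prod_range_reflect (fun x => ((x + 1 : ℕ) : ZMod p)) m]
  have hfact : ∏ x ∈ range m, ((x + 1 : ℕ) : ZMod p) = ((m.factorial : ℕ) : ZMod p) := by
    rw [← Nat.cast_prod, Finset.prod_range_add_one_eq_factorial]
  rw [hrefl, hmeven.neg_one_pow, one_mul, hfact] at hw
  rw [sq]
  exact hw

/-! ### The key congruence (abstract form) -/

/-- **The `λ`-adic comparison.** In a domain, if `P = τ ε^h = λ^m G` with `G ≡ 1 (mod λ)`,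
`m! τ ≡ -λ^m (mod λ^{m+1})` and `2ε ≡ t (mod λ)`, then `2^h m! + t^h ≡ 0 (mod λ)`.
[cite: UrbanowiczWilliams2000, Ch. II §1.1 Thm 9 (proof)] -/
theorem key_congruence {A : Type*} [CommRing A] [IsDomain A] {lam P G τ ε : A} {m h : ℕ} {t : ℤ}
    (hlam : lam ≠ 0) (hP : P = τ * ε ^ h) (hPG : P = lam ^ m * G) (hG : G - 1 ∈ Ideal.span {lam})
    (hτ : (m.factorial : A) * τ + lam ^ m ∈ Ideal.span {lam ^ (m + 1)})
    (hε : 2 * ε - (t : A) ∈ Ideal.span {lam}) :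
    ((2 ^ h * m.factorial + t ^ h : ℤ) : A) ∈ Ideal.span {lam} := by
  obtain ⟨w, hw⟩ := Ideal.mem_span_singleton'.mp hτ
  have hεh : (2 * ε) ^ h - (t : A) ^ h ∈ Ideal.span {lam} := by
    have := Ideal.mem_span_singleton.mp hε
    exact Ideal.mem_span_singleton.mpr (dvd_trans this (sub_dvd_pow_sub_pow _ _ h))
  obtain ⟨y, hy⟩ := Ideal.mem_span_singleton'.mp hεh
  obtain ⟨z, hz⟩ := Ideal.mem_span_singleton'.mp hG
  have e1 : (2 : A) ^ h * m.factorial * P = (m.factorial * τ) * (2 * ε) ^ h := by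
    rw [hP]; ring
  rw [hPG] at e1
  have hτ' : (m.factorial : A) * τ = w * lam ^ (m + 1) - lam ^ m := by linear_combination -hw
  have hε' : (2 * ε) ^ h = (t : A) ^ h + y * lam := by linear_combination -hy
  rw [hτ', hε'] at e1
  have e2 : lam ^ m * ((2 : A) ^ h * m.factorial * G) =
      lam ^ m * ((w * lam - 1) * ((t : A) ^ h + y * lam)) := by
    linear_combination e1
  have e3 := mul_left_cancel₀ (pow_ne_zero m hlam) e2
  rw [Ideal.mem_span_singleton']
  refine ⟨w * (t : A) ^ h + w * y * lam - y - (2 : A) ^ h * m.factorial * z, ?_⟩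
  push_cast
  linear_combination -e3 - (2 : A) ^ h * (m.factorial : A) * hz

/-! ### `(1 - ζ) ∩ ℤ = pℤ` in the ring of integers of the `p`-th cyclotomic field -/

open NumberField in
/-- **`(1 - ζ_p) ∩ ℤ = pℤ`** in the ring of integers of the `p`-th cyclotomic field: an integer lying
in the ideal `(1 - ζ_p)` is divisible by `p` (`1 - ζ_p` is a prime, hence a non-unit — Mathlib
`IsPrimitiveRoot.zeta_sub_one_prime'` — dividing `p`, and `xp + ya = 1` for `p ∤ a`). [folklore] -/
theorem int_dvd_of_mem_span_one_sub_zeta {K : Type*} [Field K] [CharZero K]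
    [IsCyclotomicExtension {p} ℚ K] {ζ : K} (hζ : IsPrimitiveRoot ζ p) {a : ℤ}
    (ha : (a : 𝓞 K) ∈ Ideal.span {1 - hζ.toInteger}) : (p : ℤ) ∣ a := by
  by_contra hnd
  have hprime := hζ.zeta_sub_one_prime'
  have hcopnat : Nat.Coprime p a.natAbs :=
    (Nat.Prime.coprime_iff_not_dvd hp.out).mpr (fun h => hnd (Int.natCast_dvd.mpr h))
  have hcop : IsCoprime (p : ℤ) a := by
    rw [Int.isCoprime_iff_gcd_eq_one, Int.gcd_eq_natAbs, Int.natAbs_natCast]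
    exact hcopnat
  obtain ⟨x, y, hxy⟩ := hcop
  have hdvd_a : 1 - hζ.toInteger ∣ (a : 𝓞 K) := Ideal.mem_span_singleton.mp ha
  have hdvd_p : 1 - hζ.toInteger ∣ (p : 𝓞 K) := by
    rw [show (1 : 𝓞 K) - hζ.toInteger = -(hζ.toInteger - 1) by ring, neg_dvd]
    exact hζ.toInteger_sub_one_dvd_prime'
  have hdvd_one : 1 - hζ.toInteger ∣ (1 : 𝓞 K) := by
    have h := congrArg (fun z : ℤ => (z : 𝓞 K)) hxy
    simp only [Int.cast_add, Int.cast_mul, Int.cast_one, Int.cast_natCast] at h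
    have h' : 1 - hζ.toInteger ∣ (x : 𝓞 K) * (p : 𝓞 K) + (y : 𝓞 K) * (a : 𝓞 K) :=
      dvd_add (dvd_mul_of_dvd_right hdvd_p _) (dvd_mul_of_dvd_right hdvd_a _)
    rwa [h] at h'
  have hunit : IsUnit (hζ.toInteger - 1) := by
    rw [show hζ.toInteger - 1 = -(1 - hζ.toInteger) by ring, IsUnit.neg_iff]
    exact isUnit_of_dvd_one hdvd_one
  exact hprime.not_unit hunit

/-! ### The final step in `ℤ` -/

/-- From `p ∣ 2^h m! + t^h`, `t² ≡ -4` and `(m!)² ≡ -1 (mod p)`: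
`p ∣ 2·m! - (-1)^{(h+1)/2} t` (and `h` is necessarily odd). [folklore] -/
theorem final_int_step (hp1 : p % 4 = 1) {t : ℤ} (ht : (p : ℤ) ∣ t ^ 2 + 4) (h : ℕ)
    (hdiv : (p : ℤ) ∣ 2 ^ h * ((p / 2).factorial : ℤ) + t ^ h) :
    (p : ℤ) ∣ 2 * ((p / 2).factorial : ℤ) - (-1) ^ ((h + 1) / 2) * t := by
  have hp2 : p ≠ 2 := by rintro rfl; norm_num at hp1
  have hchar := ringChar_ne_two hp2
  have hF := factorial_half_sq (p := p) hp1
  rw [← ZMod.intCast_zmod_eq_zero_iff_dvd] at ht hdiv ⊢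
  push_cast at ht hdiv hF ⊢
  set F : ZMod p := ((p / 2).factorial : ZMod p) with hFdef
  set T : ZMod p := (t : ZMod p) with hT
  have hT2 : T ^ 2 = -4 := by linear_combination ht
  have h4 : (4 : ZMod p) ≠ 0 := by
    intro h0
    have h2 : (2 : ZMod p) ≠ 0 := Ring.two_ne_zero hchar
    exact h2 (by
      have : (2 : ZMod p) * 2 = 0 := by rw [← h0]; norm_num
      rcases mul_eq_zero.mp this with h | h <;> exact h)
  rcases Nat.even_or_odd h with ⟨k, hk⟩ | ⟨k, hk⟩
  · -- `h = 2k`: impossible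
    exfalso
    rw [hk, ← two_mul] at hdiv
    have e1 : (2 : ZMod p) ^ (2 * k) * F + T ^ (2 * k) = 4 ^ k * (F + (-1) ^ k) := by
      rw [pow_mul, pow_mul, hT2, show (2 : ZMod p) ^ 2 = 4 by norm_num,
        show (-4 : ZMod p) = (-1) * 4 by ring, mul_pow]
      ring
    rw [e1] at hdiv
    have e2 : F + (-1) ^ k = 0 := (mul_eq_zero.mp hdiv).resolve_left (pow_ne_zero k h4)
    have e3 : F ^ 2 = 1 := by
      have hFk : F = -(-1) ^ k := by linear_combination e2
      rw [hFk, neg_sq]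
      rcases neg_one_pow_eq_or (ZMod p) k with h' | h' <;> simp [h']
    have h2 : (2 : ZMod p) = 0 := by linear_combination hF - e3
    exact Ring.two_ne_zero hchar h2
  · -- `h = 2k + 1`
    have hk' : (h + 1) / 2 = k + 1 := by omega
    rw [hk] at hdiv
    rw [hk']
    have e1 : (2 : ZMod p) ^ (2 * k + 1) * F + T ^ (2 * k + 1) =
        4 ^ k * (2 * F + (-1) ^ k * T) := by
      rw [pow_succ, pow_succ, pow_mul, pow_mul, hT2, show (2 : ZMod p) ^ 2 = 4 by norm_num,
        show (-4 : ZMod p) = (-1) * 4 by ring, mul_pow]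
      ring
    rw [e1] at hdiv
    have e2 : 2 * F + (-1) ^ k * T = 0 := (mul_eq_zero.mp hdiv).resolve_left (pow_ne_zero k h4)
    rw [pow_succ]
    linear_combination e2

/-! ## Piece E: the analytic identity in `ℂ`

Notation (written out in full): `χ = jacobiChar p`, `ζ = exp(2πi/p)`, `τ = gaussSum χ stdAddChar`,
`N = ∏_{NR} (1 - ζ^b)`, `Q = ∏_{QR} (1 - ζ^a)`. -/

section Analysis

open Complex

/-- `jacobiChar p = quadraticChar (ZMod p)` (values cast to `ℂ`). [folklore] -/
theorem jacobiChar_eq_quadraticChar (a : ZMod p) :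
    jacobiChar p a = (quadraticChar (ZMod p) a : ℂ) := by
  rw [jacobiChar_apply, ← jacobiSym.legendreSym.to_jacobiSym, legendreSym, Int.cast_natCast,
    ZMod.natCast_zmod_val]

/-- `χ_p = (·/p)` is non-trivial for an odd prime `p`. [folklore] -/
theorem jacobiChar_ne_one' (hp2 : p ≠ 2) : jacobiChar p ≠ 1 := by
  obtain ⟨a, ha⟩ := quadraticChar_exists_neg_one' (ringChar_ne_two hp2)
  intro h1
  have := jacobiChar_eq_quadraticChar (p := p) (a : ZMod p)
  rw [h1, MulChar.one_apply_coe, ha] at this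
  norm_num at this

/-- `χ_p` is primitive: its conductor divides the prime `p` and is not `1`. [folklore] -/
theorem jacobiChar_isPrimitive (hp2 : p ≠ 2) : (jacobiChar p).IsPrimitive := by
  rw [DirichletCharacter.isPrimitive_def]
  rcases hp.out.eq_one_or_self_of_dvd _ (DirichletCharacter.conductor_dvd_level (jacobiChar p))
    with h | h
  · exact absurd (DirichletCharacter.eq_one_iff_conductor_eq_one.mpr h) (jacobiChar_ne_one' hp2)
  · exact h

/-- `χ_p` is a quadratic character (values `0, ±1`). [folklore] -/
theorem jacobiChar_isQuadratic : (jacobiChar p).IsQuadratic := fun a => jacobiChar_trichotomy a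

/-- `χ_p` is even, `χ_p(-1) = 1`, for `p ≡ 1 (mod 4)`. [folklore] -/
theorem jacobiChar_even (hp1 : p % 4 = 1) : (jacobiChar p).Even := by
  rw [DirichletCharacter.Even, jacobiChar_eq_quadraticChar, quadraticChar_neg_eq hp1, map_one,
    Int.cast_one]

/-- `p ≡ 1 (mod 4)` forces `p ≠ 2`. [folklore] -/
theorem ne_two_of_mod_four_eq_one (hp1 : p % 4 = 1) : p ≠ 2 := by
  rintro rfl; norm_num at hp1

/-- `τ² = p`. [folklore] -/
theorem gaussSum_sq_eq (hp1 : p % 4 = 1) :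
    gaussSum (jacobiChar p) (ZMod.stdAddChar (N := p)) ^ 2 = p := by
  have hp2 := ne_two_of_mod_four_eq_one hp1
  rw [gaussSum_sq (jacobiChar_ne_one' hp2) jacobiChar_isQuadratic (ZMod.isPrimitive_stdAddChar p),
    jacobiChar_even hp1, one_mul, ZMod.card]

/-- `τ = ±√p`. [folklore] -/
theorem gaussSum_eq_or (hp1 : p % 4 = 1) :
    gaussSum (jacobiChar p) (ZMod.stdAddChar (N := p)) = (Real.sqrt p : ℂ) ∨
      gaussSum (jacobiChar p) (ZMod.stdAddChar (N := p)) = -(Real.sqrt p : ℂ) := by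
  have h := gaussSum_sq_eq hp1
  have hs : ((Real.sqrt p : ℝ) : ℂ) ^ 2 = p := by
    rw [← Complex.ofReal_pow, Real.sq_sqrt (Nat.cast_nonneg p), Complex.ofReal_natCast]
  have h0 : (gaussSum (jacobiChar p) (ZMod.stdAddChar (N := p)) - (Real.sqrt p : ℂ)) *
      (gaussSum (jacobiChar p) (ZMod.stdAddChar (N := p)) + (Real.sqrt p : ℂ)) = 0 := by
    linear_combination h - hs
  rcases mul_eq_zero.mp h0 with h0 | h0
  · left; linear_combination h0
  · right; linear_combination h0

/-- `e(j/p) = ζ^j`. [folklore] -/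
theorem stdAddChar_eq_pow (j : ZMod p) :
    ZMod.stdAddChar j = Complex.exp (2 * Real.pi * I / p) ^ j.val := by
  rw [ZMod.stdAddChar_apply, ZMod.toCircle_apply, ← Complex.exp_nat_mul]
  congr 1
  ring

/-- `e^{2πi/p}` is a primitive `p`-th root of unity in `ℂ`. [folklore] -/
theorem isPrimitiveRoot_zetaC : IsPrimitiveRoot (Complex.exp (2 * Real.pi * I / p)) p :=
  Complex.isPrimitiveRoot_exp p hp.out.ne_zero

omit hp in
/-- `|ζ^n| = 1` for `ζ = e^{2πi/p}`. [folklore] -/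
theorem norm_zetaC_pow (n : ℕ) : ‖Complex.exp (2 * Real.pi * I / p) ^ n‖ = 1 := by
  rw [norm_pow, show 2 * (Real.pi : ℂ) * I / p = ((2 * Real.pi / p : ℝ) : ℂ) * I by push_cast; ring,
    Complex.norm_exp_ofReal_mul_I, one_pow]

/-- `ζ^{(-j)} = conj (ζ^j)`. [folklore] -/
theorem zetaC_pow_neg_val (j : ZMod p) :
    Complex.exp (2 * Real.pi * I / p) ^ (-j).val =
      (starRingEnd ℂ) (Complex.exp (2 * Real.pi * I / p) ^ j.val) := by
  set ζ := Complex.exp (2 * Real.pi * I / p) with hζdef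
  have hζ : IsPrimitiveRoot ζ p := isPrimitiveRoot_zetaC
  have hconj : ∀ n : ℕ, (starRingEnd ℂ) (ζ ^ n) = (ζ ^ n)⁻¹ := by
    intro n
    have h1 : ‖ζ ^ n‖ = 1 := norm_zetaC_pow n
    rw [Complex.inv_def, Complex.normSq_eq_norm_sq, h1]
    simp
  by_cases hj : j = 0
  · subst hj
    simp
  · rw [ZMod.neg_val, if_neg hj, hconj]
    apply eq_inv_of_mul_eq_one_left
    rw [← pow_add, Nat.sub_add_cancel (ZMod.val_lt j).le, hζ.pow_eq_one]

/-- `(1 - ζ^{-j})` is the conjugate of `(1 - ζ^j)`, so the product is `‖1 - ζ^j‖²`. [folklore] -/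
theorem one_sub_mul_one_sub_neg (j : ZMod p) :
    (1 - Complex.exp (2 * Real.pi * I / p) ^ j.val) * (1 - Complex.exp (2 * Real.pi * I / p) ^ (-j).val) =
      ((‖1 - Complex.exp (2 * Real.pi * I / p) ^ j.val‖ ^ 2 : ℝ) : ℂ) := by
  rw [zetaC_pow_neg_val, ← Complex.normSq_eq_norm_sq, ← Complex.mul_conj, map_sub, map_one]

/-- `|1 - ζ^{-j}| = |1 - ζ^j|`. [folklore] -/
theorem norm_one_sub_neg (j : ZMod p) :
    ‖1 - Complex.exp (2 * Real.pi * I / p) ^ (-j).val‖ = ‖1 - Complex.exp (2 * Real.pi * I / p) ^ j.val‖ := by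
  rw [zetaC_pow_neg_val, ← map_one (starRingEnd ℂ), ← map_sub, Complex.norm_conj, map_one]

/-- `1 - ζ^j ≠ 0` for `j ≢ 0 (mod p)`. [folklore] -/
theorem norm_one_sub_pos {j : ZMod p} (hj : j ≠ 0) :
    0 < ‖1 - Complex.exp (2 * Real.pi * I / p) ^ j.val‖ := by
  have hjv : j.val ≠ 0 := (ZMod.val_ne_zero j).mpr hj
  have := isPrimitiveRoot_zetaC.pow_ne_one_of_pos_of_lt hjv (ZMod.val_lt j)
  exact norm_pos_iff.mpr (sub_ne_zero.mpr (Ne.symm this))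

/-- **A product `∏_{S} (1 - ζ^j)` over a set of non-zero residues symmetric under `j ↦ -j` is the
positive real `∏_{S} ‖1 - ζ^j‖`.** [folklore] -/
theorem prod_one_sub_eq_ofReal (hp1 : p % 4 = 1) (c : ℤ) (hc : c ≠ 0) :
    ∏ j ∈ univ.filter (fun j : ZMod p => quadraticChar (ZMod p) j = c),
        (1 - Complex.exp (2 * Real.pi * I / p) ^ j.val) =
      ((∏ j ∈ univ.filter (fun j : ZMod p => quadraticChar (ZMod p) j = c),
        ‖1 - Complex.exp (2 * Real.pi * I / p) ^ j.val‖ : ℝ) : ℂ) := by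
  have hp2 := ne_two_of_mod_four_eq_one hp1
  have hfilter : univ.filter (fun j : ZMod p => quadraticChar (ZMod p) j = c) =
      univ.filter (fun j : ZMod p => j ≠ 0 ∧ quadraticChar (ZMod p) j = c) := by
    refine Finset.filter_congr fun j _ => ⟨fun h => ⟨ne_zero_of_quadraticChar_eq hc h, h⟩, fun h => h.2⟩
  have hsymm : ∀ j : ZMod p, quadraticChar (ZMod p) (-j) = c ↔ quadraticChar (ZMod p) j = c := by
    intro j; rw [quadraticChar_neg_eq hp1]
  rw [hfilter, prod_filter_eq_prod_half hp2 _ _ hsymm, prod_filter_eq_prod_half hp2 _ _ hsymm,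
    Complex.ofReal_prod]
  refine Finset.prod_congr rfl fun j _ => ?_
  rw [one_sub_mul_one_sub_neg, norm_one_sub_neg, sq, Complex.ofReal_mul]

/-- `∏_{χ(j) = c} |1 - ζ^j| > 0` (`c = ±1`). [folklore] -/
theorem prod_norm_one_sub_pos (c : ℤ) (hc : c ≠ 0) :
    0 < ∏ j ∈ univ.filter (fun j : ZMod p => quadraticChar (ZMod p) j = c),
        ‖1 - Complex.exp (2 * Real.pi * I / p) ^ j.val‖ := by
  refine Finset.prod_pos fun j hj => ?_
  simp only [Finset.mem_filter, Finset.mem_univ, true_and] at hj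
  exact norm_one_sub_pos (ne_zero_of_quadraticChar_eq hc hj)

/-- `N_ℝ · Q_ℝ = p`. [folklore] -/
theorem prod_norm_qr_mul_prod_norm_nr :
    (∏ j ∈ univ.filter (fun j : ZMod p => quadraticChar (ZMod p) j = 1),
        ‖1 - Complex.exp (2 * Real.pi * I / p) ^ j.val‖) *
      (∏ j ∈ univ.filter (fun j : ZMod p => quadraticChar (ZMod p) j = -1),
        ‖1 - Complex.exp (2 * Real.pi * I / p) ^ j.val‖) = p := by
  rw [← Finset.prod_union disjoint_qr_nr, ← filter_ne_zero_eq_qr_union_nr, ← norm_prod,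
    prod_one_sub_pow_eq_prime isPrimitiveRoot_zetaC, Complex.norm_natCast]

/-- Linearity of `ZMod.LFunction` in the coefficient function. [folklore] -/
theorem LFunction_const_mul {N : ℕ} [NeZero N] (c : ℂ) (Φ : ZMod N → ℂ) (s : ℂ) :
    ZMod.LFunction (fun j => c * Φ j) s = c * ZMod.LFunction Φ s := by
  simp only [ZMod.LFunction, Finset.mul_sum]
  exact Finset.sum_congr rfl fun j _ => by ring

/-- **`τ · L(1, χ) = -∑_j χ(j) log(1 - ζ^j)`** (U–W Ch. I §5.1 (13)–(14); Mathlib's `LFunction_dft`,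
the Fourier transform of a primitive character, and `expZeta a 1 = -log(1 - e(a))`).
[cite: UrbanowiczWilliams2000, Ch. I §5.1 (13)–(14)] -/
theorem gaussSum_mul_LFunction_one (hp1 : p % 4 = 1) :
    gaussSum (jacobiChar p) (ZMod.stdAddChar (N := p)) * (jacobiChar p).LFunction 1 =
      -∑ j : ZMod p, jacobiChar p j *
        Complex.log (1 - Complex.exp (2 * Real.pi * I / p) ^ j.val) := by
  have hp2 := ne_two_of_mod_four_eq_one hp1
  set χ := jacobiChar p with hχdef
  set τ := gaussSum χ (ZMod.stdAddChar (N := p)) with hτdef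
  set ζ := Complex.exp (2 * Real.pi * I / p) with hζdef
  have hζ : IsPrimitiveRoot ζ p := isPrimitiveRoot_zetaC
  have hprim := jacobiChar_isPrimitive hp2
  have heven := jacobiChar_even hp1
  -- the Fourier transform of `χ` is `τ · χ`
  have hF : ZMod.dft (⇑χ) = fun k => τ * χ k := by
    funext k
    rw [hprim.fourierTransform_eq_inv_mul_gaussSum, jacobiChar_isQuadratic.inv,
      heven.to_fun k, mul_comm]
  have h1 := ZMod.LFunction_dft (⇑χ) (s := 1) (Or.inl (MulChar.map_zero χ))
  rw [hF, LFunction_const_mul] at h1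
  -- reindex `j ↦ -j`
  have h2 : (∑ j : ZMod p, χ j * HurwitzZeta.expZeta (ZMod.toAddCircle (-j)) 1) =
      ∑ j : ZMod p, χ j * HurwitzZeta.expZeta (ZMod.toAddCircle j) 1 := by
    refine Fintype.sum_equiv (Equiv.neg (ZMod p)) _ _ fun j => ?_
    simp only [Equiv.neg_apply]
    rw [heven.to_fun j]
  -- evaluate `expZeta (j/p) 1`
  have h3 : ∀ j : ZMod p, χ j * HurwitzZeta.expZeta (ZMod.toAddCircle j) 1 =
      -(χ j * Complex.log (1 - ζ ^ j.val)) := by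
    intro j
    by_cases hj : j = 0
    · rw [hj, MulChar.map_zero, zero_mul, zero_mul, neg_zero]
    · have hjv : j.val ≠ 0 := (ZMod.val_ne_zero j).mpr hj
      have hexp : Complex.exp (2 * Real.pi * I * ((j.val : ℝ) / p : ℝ)) = ζ ^ j.val := by
        rw [hζdef, ← Complex.exp_nat_mul]
        congr 1
        push_cast
        ring
      have hne : Complex.exp (2 * Real.pi * I * ((j.val : ℝ) / p : ℝ)) ≠ 1 := by
        rw [hexp]
        exact hζ.pow_ne_one_of_pos_of_lt hjv (ZMod.val_lt j)
      rw [ZMod.toAddCircle_apply,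
        Literature.NumberTheory.Transcendental.KoblitzOgus.expZeta_one _ hne, hexp]
      ring
  rw [Finset.sum_congr rfl (fun j _ => h3 j), Finset.sum_neg_distrib] at h2
  rw [← h2, ← h1, DirichletCharacter.LFunction]

/-- Real part of `χ(j) log(1 - ζ^j)`. [folklore] -/
theorem re_jacobiChar_mul_log (j : ZMod p) :
    (jacobiChar p j * Complex.log (1 - Complex.exp (2 * Real.pi * I / p) ^ j.val)).re =
      (quadraticChar (ZMod p) j : ℝ) * Real.log ‖1 - Complex.exp (2 * Real.pi * I / p) ^ j.val‖ := by
  rw [jacobiChar_eq_quadraticChar, show ((quadraticChar (ZMod p) j : ℤ) : ℂ) =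
    (((quadraticChar (ZMod p) j : ℤ) : ℝ) : ℂ) by norm_cast, Complex.re_ofReal_mul, Complex.log_re]

/-- `∑_j χ(j) log ‖1 - ζ^j‖ = log Q_ℝ - log N_ℝ`. [folklore] -/
theorem sum_quadraticChar_mul_log :
    ∑ j : ZMod p, (quadraticChar (ZMod p) j : ℝ) * Real.log ‖1 - Complex.exp (2 * Real.pi * I / p) ^ j.val‖ =
      Real.log (∏ j ∈ univ.filter (fun j : ZMod p => quadraticChar (ZMod p) j = 1),
          ‖1 - Complex.exp (2 * Real.pi * I / p) ^ j.val‖) -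
        Real.log (∏ j ∈ univ.filter (fun j : ZMod p => quadraticChar (ZMod p) j = -1),
          ‖1 - Complex.exp (2 * Real.pi * I / p) ^ j.val‖) := by
  -- drop the term `j = 0`
  have hsplit : ∑ j : ZMod p, (quadraticChar (ZMod p) j : ℝ) *
      Real.log ‖1 - Complex.exp (2 * Real.pi * I / p) ^ j.val‖ =
      ∑ j ∈ (univ : Finset (ZMod p)).filter (· ≠ 0), (quadraticChar (ZMod p) j : ℝ) *
        Real.log ‖1 - Complex.exp (2 * Real.pi * I / p) ^ j.val‖ := by
    rw [Finset.sum_filter_of_ne]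
    intro j _ hj h0
    apply hj
    rw [h0, quadraticChar_zero, Int.cast_zero, zero_mul]
  rw [hsplit, filter_ne_zero_eq_qr_union_nr, Finset.sum_union disjoint_qr_nr,
    Real.log_prod (fun j hj => ?_), Real.log_prod (fun j hj => ?_)]
  · rw [sub_eq_add_neg, ← Finset.sum_neg_distrib]
    congr 1
    · refine Finset.sum_congr rfl fun j hj => ?_
      simp only [Finset.mem_filter, Finset.mem_univ, true_and] at hj
      rw [hj, Int.cast_one, one_mul]
    · refine Finset.sum_congr rfl fun j hj => ?_
      simp only [Finset.mem_filter, Finset.mem_univ, true_and] at hj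
      rw [hj]
      push_cast
      ring
  · simp only [Finset.mem_filter, Finset.mem_univ, true_and] at hj
    exact (norm_one_sub_pos (ne_zero_of_quadraticChar_eq (by norm_num) hj)).ne'
  · simp only [Finset.mem_filter, Finset.mem_univ, true_and] at hj
    exact (norm_one_sub_pos (ne_zero_of_quadraticChar_eq (by norm_num) hj)).ne'

/-- **The analytic dichotomy.** If `L(1, χ) = 2 h log ε₀ / √p` with `ε₀ > 0`, then either
`τ = √p` and `N = τ ε₀^h`, or `τ = -√p` and `-Q = τ ε₀^h`.
[cite: UrbanowiczWilliams2000, Ch. II §1.1 Thm 9 (proof)] -/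
theorem analytic_dichotomy (hp1 : p % 4 = 1) {ε₀ : ℝ} (hε₀ : 0 < ε₀) {h : ℕ}
    (hL : (jacobiChar p).LFunction 1 = ((2 * h * Real.log ε₀ / Real.sqrt p : ℝ) : ℂ)) :
    (gaussSum (jacobiChar p) (ZMod.stdAddChar (N := p)) = (Real.sqrt p : ℂ) ∧
      ∏ j ∈ univ.filter (fun j : ZMod p => quadraticChar (ZMod p) j = -1),
          (1 - Complex.exp (2 * Real.pi * I / p) ^ j.val) =
        gaussSum (jacobiChar p) (ZMod.stdAddChar (N := p)) * (ε₀ : ℂ) ^ h) ∨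
    (gaussSum (jacobiChar p) (ZMod.stdAddChar (N := p)) = -(Real.sqrt p : ℂ) ∧
      -∏ j ∈ univ.filter (fun j : ZMod p => quadraticChar (ZMod p) j = 1),
          (1 - Complex.exp (2 * Real.pi * I / p) ^ j.val) =
        gaussSum (jacobiChar p) (ZMod.stdAddChar (N := p)) * (ε₀ : ℂ) ^ h) := by
  have hp2 := ne_two_of_mod_four_eq_one hp1
  have hp0 : (0 : ℝ) < p := by exact_mod_cast hp.out.pos
  have hsqrt : 0 < Real.sqrt p := Real.sqrt_pos.mpr hp0
  set Qr := ∏ j ∈ univ.filter (fun j : ZMod p => quadraticChar (ZMod p) j = 1),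
    ‖1 - Complex.exp (2 * Real.pi * I / p) ^ j.val‖ with hQr
  set Nr := ∏ j ∈ univ.filter (fun j : ZMod p => quadraticChar (ZMod p) j = -1),
    ‖1 - Complex.exp (2 * Real.pi * I / p) ^ j.val‖ with hNr
  have hQpos : 0 < Qr := prod_norm_one_sub_pos 1 one_ne_zero
  have hNpos : 0 < Nr := prod_norm_one_sub_pos (-1) (by norm_num)
  have hNQ : Qr * Nr = p := prod_norm_qr_mul_prod_norm_nr
  have hmain := gaussSum_mul_LFunction_one hp1
  -- real parts: `Re(τ L) = -(log Q - log N)`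
  have hre : (gaussSum (jacobiChar p) (ZMod.stdAddChar (N := p)) * (jacobiChar p).LFunction 1).re =
      -(Real.log Qr - Real.log Nr) := by
    rw [hmain, Complex.neg_re, Complex.re_sum, ← sum_quadraticChar_mul_log]
    exact congrArg Neg.neg (Finset.sum_congr rfl fun j _ => re_jacobiChar_mul_log j)
  have hQC := prod_one_sub_eq_ofReal hp1 1 one_ne_zero
  have hNC := prod_one_sub_eq_ofReal hp1 (-1) (by norm_num)
  rcases gaussSum_eq_or hp1 with hτ | hτ
  · left
    refine ⟨hτ, ?_⟩
    -- `√p · (2h log ε₀/√p) = 2 h log ε₀`, so `log N - log Q = 2h log ε₀`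
    rw [hτ, hL, ← Complex.ofReal_mul, Complex.ofReal_re] at hre
    have hlog : Real.log Nr = Real.log (Qr * ε₀ ^ (2 * h)) := by
      rw [Real.log_mul hQpos.ne' (pow_ne_zero _ hε₀.ne'), Real.log_pow]
      field_simp at hre
      push_cast
      linarith
    have hN : Nr = Qr * ε₀ ^ (2 * h) :=
      Real.log_injOn_pos (Set.mem_Ioi.mpr hNpos) (Set.mem_Ioi.mpr (by positivity)) hlog
    have hN2 : Nr ^ 2 = (Real.sqrt p * ε₀ ^ h) ^ 2 := by
      calc Nr ^ 2 = (Qr * ε₀ ^ (2 * h)) * Nr := by rw [← hN, sq]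
        _ = (Qr * Nr) * (ε₀ ^ h) ^ 2 := by rw [pow_mul']; ring
        _ = (Real.sqrt p * ε₀ ^ h) ^ 2 := by rw [hNQ, mul_pow, Real.sq_sqrt hp0.le]
    have hN' : Nr = Real.sqrt p * ε₀ ^ h :=
      (sq_eq_sq₀ hNpos.le (by positivity)).mp hN2
    rw [hNC, ← hNr, hN', hτ]
    push_cast
    ring
  · right
    refine ⟨hτ, ?_⟩
    rw [hτ, hL, neg_mul, ← Complex.ofReal_mul, Complex.neg_re, Complex.ofReal_re] at hre
    have hlog : Real.log Qr = Real.log (Nr * ε₀ ^ (2 * h)) := by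
      rw [Real.log_mul hNpos.ne' (pow_ne_zero _ hε₀.ne'), Real.log_pow]
      field_simp at hre
      push_cast
      linarith
    have hQ : Qr = Nr * ε₀ ^ (2 * h) :=
      Real.log_injOn_pos (Set.mem_Ioi.mpr hQpos) (Set.mem_Ioi.mpr (by positivity)) hlog
    have hQ2 : Qr ^ 2 = (Real.sqrt p * ε₀ ^ h) ^ 2 := by
      calc Qr ^ 2 = (Nr * ε₀ ^ (2 * h)) * Qr := by rw [← hQ, sq]
        _ = (Qr * Nr) * (ε₀ ^ h) ^ 2 := by rw [pow_mul']; ring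
        _ = (Real.sqrt p * ε₀ ^ h) ^ 2 := by rw [hNQ, mul_pow, Real.sq_sqrt hp0.le]
    have hQ' : Qr = Real.sqrt p * ε₀ ^ h :=
      (sq_eq_sq₀ hQpos.le (by positivity)).mp hQ2
    rw [hQC, ← hQr, hQ', hτ]
    push_cast
    ring

end Analysis

/-! ## Piece F: the fundamental unit and the regulator of `K`, and `L(1, χ) = 2 h log ε₀ / √p` -/

section Descent

omit hp in
/-- Parity: `t ≡ u (mod 2)` for a solution of `t² + 4 = p u²` with `p` odd. [folklore] -/
theorem even_iff_even_of_sol {t u : ℕ} (hpodd : Odd p) (htu : t ^ 2 + 4 = p * u ^ 2) :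
    (Even t ↔ Even u) := by
  have h : Even (t ^ 2 + 4) ↔ Even (p * u ^ 2) := by rw [htu]
  rw [Nat.even_add, Nat.even_pow' two_ne_zero, Nat.even_mul, Nat.even_pow' two_ne_zero] at h
  have h4 : Even (4 : ℕ) := ⟨2, rfl⟩
  have hp' : ¬ Even p := Nat.not_even_iff_odd.mpr hpodd
  tauto

omit hp in
/-- Parity: `X ≡ Y (mod 2)` for a solution of `X² - p Y² = 4` with `p` odd. [folklore] -/
theorem int_even_iff_even_of_sol (hpodd : Odd p) {X Y : ℤ} (h : X ^ 2 - p * Y ^ 2 = 4) :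
    (Even X ↔ Even Y) := by
  have h' : Even (X ^ 2 - p * Y ^ 2) ↔ Even (4 : ℤ) := by rw [h]
  rw [Int.even_sub, Int.even_pow' two_ne_zero, Int.even_mul, Int.even_pow' two_ne_zero] at h'
  have h4 : Even (4 : ℤ) := ⟨2, rfl⟩
  have hp' : ¬ Even (p : ℤ) := by
    rw [Int.even_coe_nat]
    exact Nat.not_even_iff_odd.mpr hpodd
  tauto

omit hp in
/-- The real-variable core of the descent: with `e₀ = (t + u s)/2`, `η = (X + Y s)/2`,
`μ = (A + B s)/2 = e₀ η̄`, if `η < e₀` then `A, B > 0` and `μ < e₀`. [folklore] -/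
theorem descent_real {s tt uu X Y A B : ℝ} (hs : 2 < s) (ht : 0 ≤ tt) (hu : 1 ≤ uu) (hX : 1 ≤ X)
    (hY : 1 ≤ Y) (hee : tt ^ 2 - uu ^ 2 * s ^ 2 = -4) (hηη : X ^ 2 - Y ^ 2 * s ^ 2 = 4)
    (hA : 2 * A = tt * X - s ^ 2 * uu * Y) (hB : 2 * B = uu * X - tt * Y)
    (hlt : (X + Y * s) / 2 < (tt + uu * s) / 2) :
    0 < A ∧ 0 < B ∧ (A + B * s) / 2 < (tt + uu * s) / 2 := by
  have hs0 : 0 < s := by linarith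
  -- the six real numbers
  have he₀ : 1 < (tt + uu * s) / 2 := by nlinarith
  have hη : 1 < (X + Y * s) / 2 := by nlinarith
  have hprod_e : (tt + uu * s) / 2 * ((tt - uu * s) / 2) = -1 := by nlinarith
  have hprod_η : (X + Y * s) / 2 * ((X - Y * s) / 2) = 1 := by nlinarith
  have hμ : (A + B * s) / 2 = (tt + uu * s) / 2 * ((X - Y * s) / 2) := by nlinarith
  have hμ' : (A - B * s) / 2 = (tt - uu * s) / 2 * ((X + Y * s) / 2) := by nlinarith
  -- `η̄ = 1/η ∈ (0, 1)`
  have hη'pos : 0 < (X - Y * s) / 2 :=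
    (pos_iff_pos_of_mul_pos (by rw [hprod_η]; exact one_pos)).mp (by linarith)
  have hη'lt : (X - Y * s) / 2 < 1 := by nlinarith
  -- `ē₀ = -1/e₀ ∈ (-1, 0)`
  have he'neg : (tt - uu * s) / 2 < 0 := by nlinarith
  have he'gt : -1 < (tt - uu * s) / 2 := by nlinarith
  -- `μ > 1`, `μ < e₀`, `-1 < μ' < 0`
  have hμ1 : 1 < (A + B * s) / 2 := by
    rw [hμ]
    calc (1 : ℝ) = (X + Y * s) / 2 * ((X - Y * s) / 2) := hprod_η.symm
      _ < (tt + uu * s) / 2 * ((X - Y * s) / 2) := mul_lt_mul_of_pos_right hlt hη'pos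
  have hμlt : (A + B * s) / 2 < (tt + uu * s) / 2 := by
    rw [hμ]
    calc (tt + uu * s) / 2 * ((X - Y * s) / 2) < (tt + uu * s) / 2 * 1 :=
          mul_lt_mul_of_pos_left hη'lt (by linarith)
      _ = (tt + uu * s) / 2 := mul_one _
  have hμ'neg : (A - B * s) / 2 < 0 := by
    rw [hμ']
    exact mul_neg_of_neg_of_pos he'neg (by linarith)
  have hμ'gt : -1 < (A - B * s) / 2 := by
    rw [hμ']
    -- `ē₀ η > -1` iff `η < e₀` (as `ē₀ = -1/e₀`)
    have : (tt - uu * s) / 2 * ((X + Y * s) / 2) = -((X + Y * s) / 2 / ((tt + uu * s) / 2)) := by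
      field_simp
      nlinarith
    rw [this, neg_lt_neg_iff, div_lt_one (by linarith)]
    exact hlt
  refine ⟨?_, ?_, hμlt⟩
  · have : A = (A + B * s) / 2 + (A - B * s) / 2 := by ring
    linarith
  · have : B * s = (A + B * s) / 2 - (A - B * s) / 2 := by ring
    have hBs : 0 < B * s := by linarith
    exact (pos_iff_pos_of_mul_pos hBs).mpr hs0

/-- **Minimality of `ε₀ = (t + u√p)/2` among all `(X + Y√p)/2` with `X² - pY² = ±4`,
`X, Y ≥ 1`**, given that `t` is least among the solutions of `t² + 4 = p u²`: the case `-4` is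
immediate; in the case `+4`, if `η = (X + Y√p)/2 < ε₀` then `μ = ε₀ η̄ = (A + B√p)/2` is a
smaller solution of norm `-1` with `A, B ≥ 1`, contradicting the minimality of `t`. [folklore] -/
theorem eps_le_of_sol (hp1 : p % 4 = 1) {t u : ℕ} (htu : t ^ 2 + 4 = p * u ^ 2) (hu : 0 < u)
    (hmin : ∀ t' u' : ℕ, t' ^ 2 + 4 = p * u' ^ 2 → 0 < u' → t ≤ t') {X Y : ℤ} (hX : 1 ≤ X)
    (hY : 1 ≤ Y) (hXY : X ^ 2 - p * Y ^ 2 = 4 ∨ X ^ 2 - p * Y ^ 2 = -4) :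
    ((t : ℝ) + u * Real.sqrt p) / 2 ≤ (X + Y * Real.sqrt p) / 2 := by
  have hp2 : p ≠ 2 := ne_two_of_mod_four_eq_one hp1
  have hpodd : Odd p := hp.out.odd_of_ne_two hp2
  have h4p : 4 < p := by have := hp.out.two_le; omega
  set s := Real.sqrt p with hsdef
  have hs2 : s ^ 2 = p := Real.sq_sqrt (Nat.cast_nonneg p)
  have hs : 2 < s := by
    rw [hsdef, show (2 : ℝ) = Real.sqrt 4 by
      rw [show (4 : ℝ) = 2 ^ 2 by norm_num, Real.sqrt_sq (by norm_num)]]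
    exact Real.sqrt_lt_sqrt (by norm_num) (by exact_mod_cast h4p)
  have hs0 : 0 ≤ s := Real.sqrt_nonneg _
  -- monotonicity in `t`
  have hmono : ∀ t' u' : ℕ, t' ^ 2 + 4 = p * u' ^ 2 → t ≤ t' →
      ((t : ℝ) + u * s) / 2 ≤ ((t' : ℝ) + u' * s) / 2 := by
    intro t' u' ht' htt'
    have huu' : u ≤ u' := by
      have h1 : p * u ^ 2 ≤ p * u' ^ 2 := by
        rw [← htu, ← ht']
        exact Nat.add_le_add_right (Nat.pow_le_pow_left htt' 2) 4
      have h2 := Nat.le_of_mul_le_mul_left h1 hp.out.pos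
      exact (Nat.pow_le_pow_iff_left two_ne_zero).mp h2
    have h1 : (t : ℝ) ≤ t' := by exact_mod_cast htt'
    have h2 : (u : ℝ) ≤ u' := by exact_mod_cast huu'
    nlinarith
  rcases hXY with hXY | hXY
  · -- the case `+4`: descent
    rcases le_or_gt (((t : ℝ) + u * s) / 2) ((X + Y * s) / 2) with hle | hlt
    · exact hle
    exfalso
    have htu_par := even_iff_even_of_sol hpodd htu
    have hXY_par := int_even_iff_even_of_sol hpodd hXY
    have hpe : ¬ Even p := Nat.not_even_iff_odd.mpr hpodd
    have hA2 : (2 : ℤ) ∣ t * X - p * u * Y := by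
      rw [← even_iff_two_dvd]
      simp only [Int.even_sub, Int.even_mul, Int.even_coe_nat]
      tauto
    have hB2 : (2 : ℤ) ∣ u * X - t * Y := by
      rw [← even_iff_two_dvd]
      simp only [Int.even_sub, Int.even_mul, Int.even_coe_nat]
      tauto
    obtain ⟨A, hA⟩ := hA2
    obtain ⟨B, hB⟩ := hB2
    have htu' : (t : ℤ) ^ 2 + 4 = p * u ^ 2 := by exact_mod_cast htu
    have hAB : A ^ 2 - p * B ^ 2 = -4 := by
      have e : (2 * A) ^ 2 - p * (2 * B) ^ 2 = -16 := by
        rw [← hA, ← hB]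
        linear_combination ((X : ℤ) ^ 2 - p * Y ^ 2) * htu' - 4 * hXY
      linarith
    -- the real-variable descent
    have hreal := descent_real (tt := t) (uu := u) (X := X) (Y := Y) (A := A) (B := B) hs
      (Nat.cast_nonneg t) (by exact_mod_cast hu) (by exact_mod_cast hX) (by exact_mod_cast hY)
      (by rw [hs2]; exact_mod_cast (by linarith : (t : ℤ) ^ 2 - u ^ 2 * p = -4))
      (by rw [hs2]; exact_mod_cast (by linarith : (X : ℤ) ^ 2 - Y ^ 2 * p = 4))
      (by rw [hs2]; exact_mod_cast (by linarith : 2 * A = (t : ℤ) * X - p * u * Y))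
      (by exact_mod_cast (by linarith : 2 * B = (u : ℤ) * X - t * Y)) hlt
    obtain ⟨hApos, hBpos, hμlt⟩ := hreal
    have hA1 : 1 ≤ A := by exact_mod_cast hApos
    have hB1 : 1 ≤ B := by exact_mod_cast hBpos
    lift A to ℕ using (by omega) with A' hA'
    lift B to ℕ using (by omega) with B' hB'
    have hAB' : A' ^ 2 + 4 = p * B' ^ 2 := by
      have : (A' : ℤ) ^ 2 + 4 = p * B' ^ 2 := by linarith
      exact_mod_cast this
    have hle := hmono A' B' hAB' (hmin A' B' hAB' (by exact_mod_cast hB1))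
    push_cast at hμlt
    linarith
  · -- the case `-4`
    lift X to ℕ using (by omega) with t' ht'
    lift Y to ℕ using (by omega) with u' hu'
    have hsol : t' ^ 2 + 4 = p * u' ^ 2 := by
      have : (t' : ℤ) ^ 2 + 4 = p * u' ^ 2 := by linarith
      exact_mod_cast this
    have hle := hmono t' u' hsol (hmin t' u' hsol (by exact_mod_cast hY))
    push_cast
    exact hle

end Descent

section UnitRegulator

open NumberField NumberField.Units Literature.NumberTheory.QuadraticFields.Quadratic

/-- Changing the level of `jacobiChar` along an equality of naturals. [folklore] -/
theorem LFunction_jacobiChar_level_congr {n n' : ℕ} [NeZero n] [NeZero n'] (h : n = n') (s : ℂ) :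
    (jacobiChar n).LFunction s = (jacobiChar n').LFunction s := by
  subst h
  rfl

variable {K : Type*} [Field K] [NumberField K]

/-- **`L(1, χ_p) = 2 h log ε₀ / √p`** for a quadratic field `K` of discriminant `p ≡ 1 (mod 4)`,
`h = h_K`, `ε₀ = (t + u√p)/2` with `(t, u)` the least solution of `t² + 4 = p u²`: Dirichlet's
class number formula (`LFunction_jacobiChar_one_eq_of_discr_pos`) with `w_K = 2` and
`R_K = log ε₀` (`regulator_eq_log_of_minimal`, the unit `(t - ut₁)/2 + uω` and `eps_le_of_sol`).
(U–W Ch. I §8.2 (18).) [cite: UrbanowiczWilliams2000, Ch. I §8.2 (18)] -/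
theorem LFunction_one_eq_of_minimal (hp1 : p % 4 = 1) (h2 : Module.finrank ℚ K = 2)
    (hdisc : NumberField.discr K = p) {t u : ℕ} (htu : t ^ 2 + 4 = p * u ^ 2) (hu : 0 < u)
    (hmin : ∀ t' u' : ℕ, t' ^ 2 + 4 = p * u' ^ 2 → 0 < u' → t ≤ t') :
    (jacobiChar p).LFunction 1 =
      ((2 * classNumber K * Real.log (((t : ℝ) + u * Real.sqrt p) / 2) / Real.sqrt p : ℝ) : ℂ) := by
  have hp2 := ne_two_of_mod_four_eq_one hp1
  have hpodd : Odd p := hp.out.odd_of_ne_two hp2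
  have h4p : 4 < p := by have := hp.out.two_le; omega
  have hd : 0 < NumberField.discr K := by rw [hdisc]; exact_mod_cast hp.out.pos
  have hodd : Odd (NumberField.discr K) := by rw [hdisc]; exact_mod_cast hpodd
  obtain ⟨b, hb⟩ := exists_basis_zero_eq_one (K := K) h2
  set t₁ : ℤ := b.repr (b 1 * b 1) 1 with ht₁
  set m₁ : ℤ := b.repr (b 1 * b 1) 0 with hm₁
  have hω : b 1 * b 1 = (m₁ : 𝓞 K) + (t₁ : 𝓞 K) * b 1 := basis_one_mul_self_eq b hb
  have hp' : t₁ ^ 2 + 4 * m₁ = p := by rw [← hdisc]; exact (discr_eq_sq_add_four_mul b hb).symm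
  -- `√p` and `ε₀`
  set s := Real.sqrt p with hsdef
  have hs2 : s ^ 2 = p := Real.sq_sqrt (Nat.cast_nonneg p)
  have hs : 2 < s := by
    rw [hsdef, show (2 : ℝ) = Real.sqrt 4 by
      rw [show (4 : ℝ) = 2 ^ 2 by norm_num, Real.sqrt_sq (by norm_num)]]
    exact Real.sqrt_lt_sqrt (by norm_num) (by exact_mod_cast h4p)
  have hu1 : (1 : ℝ) ≤ u := by exact_mod_cast hu
  have ht0 : (0 : ℝ) ≤ t := Nat.cast_nonneg t
  have hε₀ : 1 < ((t : ℝ) + u * s) / 2 := by nlinarith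
  have htu' : (t : ℤ) ^ 2 + 4 = p * u ^ 2 := by exact_mod_cast htu
  have htuR : (t : ℝ) ^ 2 + 4 = p * u ^ 2 := by exact_mod_cast htu
  -- parities: `t ≡ u (mod 2)`, `t₁` odd
  have htpar : Even t ↔ Even u := even_iff_even_of_sol hpodd htu
  have ht₁ : ¬ Even t₁ := by
    have h1 : ¬ Even (t₁ ^ 2 + 4 * m₁) := by
      rw [hp', Int.even_coe_nat]
      exact Nat.not_even_iff_odd.mpr hpodd
    rw [Int.even_add, Int.even_pow' two_ne_zero] at h1
    have h4 : Even (4 * m₁) := ⟨2 * m₁, by ring⟩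
    tauto
  have hA2 : (2 : ℤ) ∣ (t : ℤ) - u * t₁ := by
    rw [← even_iff_two_dvd, Int.even_sub, Int.even_mul, Int.even_coe_nat, Int.even_coe_nat]
    tauto
  have hB2 : (2 : ℤ) ∣ (t : ℤ) + u * t₁ := by
    rw [← even_iff_two_dvd, Int.even_add, Int.even_mul, Int.even_coe_nat, Int.even_coe_nat]
    tauto
  obtain ⟨A₀, hA₀⟩ := hA2
  obtain ⟨B₀, hB₀⟩ := hB2
  have hBA : B₀ - A₀ = u * t₁ := by linarith
  have hABint : A₀ * B₀ - (u : ℤ) ^ 2 * m₁ + 1 = 0 := by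
    have e : (2 * A₀) * (2 * B₀) = ((t : ℤ) - u * t₁) * ((t : ℤ) + u * t₁) := by rw [← hA₀, ← hB₀]
    have h4 : 4 * (A₀ * B₀ - (u : ℤ) ^ 2 * m₁ + 1) = 0 := by
      linear_combination e - (u : ℤ) ^ 2 * hp' + htu'
    linarith
  -- the unit `e₁ = A₀ + uω` with `e₁ e₂ = -1`, `e₂ = B₀ - uω`
  set e₁ : 𝓞 K := (A₀ : 𝓞 K) + (u : 𝓞 K) * b 1 with he₁
  set e₂ : 𝓞 K := (B₀ : 𝓞 K) - (u : 𝓞 K) * b 1 with he₂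
  have hprod : e₁ * e₂ = -1 := by
    have c1 : ((A₀ * B₀ - (u : ℤ) ^ 2 * m₁ + 1 : ℤ) : 𝓞 K) = 0 := by rw [hABint, Int.cast_zero]
    have c2 : ((B₀ - A₀ : ℤ) : 𝓞 K) = ((u * t₁ : ℤ) : 𝓞 K) := by rw [hBA]
    push_cast at c1 c2
    rw [he₁, he₂]
    linear_combination (-((u : 𝓞 K) ^ 2)) * hω + c1 + ((u : 𝓞 K) * b 1) * c2
  set ε : (𝓞 K)ˣ := ⟨e₁, -e₂, by rw [mul_neg, hprod, neg_neg],
    by rw [neg_mul, mul_comm, hprod, neg_neg]⟩ with hεdef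
  -- its size under the real embeddings
  have hε : ∀ σ : K →+* ℝ, |Real.log (|σ ((ε : 𝓞 K) : K)|)| = Real.log (((t : ℝ) + u * s) / 2) := by
    intro σ
    have hval : σ ((ε : 𝓞 K) : K) = (A₀ : ℝ) + u * σ (b 1 : K) := by
      have h := congrArg (σ.comp (algebraMap (𝓞 K) K)) he₁
      simp only [map_add, map_mul, map_intCast, map_natCast, RingHom.comp_apply] at h
      exact h
    have hδ := ringHom_delta_sq b hω σ
    rw [hp'] at hδ
    push_cast at hδ
    have hδ' : 2 * σ (b 1 : K) - t₁ = s ∨ 2 * σ (b 1 : K) - t₁ = -s := by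
      have h0 : (2 * σ (b 1 : K) - t₁ - s) * (2 * σ (b 1 : K) - t₁ + s) = 0 := by
        nlinarith [hδ, hs2]
      rcases mul_eq_zero.mp h0 with h | h
      · left; linarith
      · right; linarith
    have hA₀R : (2 * A₀ : ℝ) = t - u * t₁ := by exact_mod_cast hA₀.symm
    have hlogpos : 0 < Real.log (((t : ℝ) + u * s) / 2) := Real.log_pos hε₀
    rcases hδ' with hδ' | hδ'
    · have hσe : σ ((ε : 𝓞 K) : K) = ((t : ℝ) + u * s) / 2 := by
        rw [hval]
        linear_combination (1 / 2 : ℝ) * hA₀R + ((u : ℝ) / 2) * hδ'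
      have habs : |σ ((ε : 𝓞 K) : K)| = ((t : ℝ) + u * s) / 2 := by
        rw [hσe, abs_of_pos (by linarith)]
      rw [habs, abs_of_pos hlogpos]
    · have hσe : σ ((ε : 𝓞 K) : K) = ((t : ℝ) - u * s) / 2 := by
        rw [hval]
        linear_combination (1 / 2 : ℝ) * hA₀R + ((u : ℝ) / 2) * hδ'
      have hprodR : ((t : ℝ) + u * s) / 2 * (((t : ℝ) - u * s) / 2) = -1 := by nlinarith
      have hinv : ((t : ℝ) - u * s) / 2 = -(((t : ℝ) + u * s) / 2)⁻¹ := by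
        have hne : ((t : ℝ) + u * s) / 2 ≠ 0 := by linarith
        field_simp
        linarith
      have habs : |σ ((ε : 𝓞 K) : K)| = (((t : ℝ) + u * s) / 2)⁻¹ := by
        rw [hσe, hinv, abs_neg, abs_inv, abs_of_pos (by linarith)]
      rw [habs, Real.log_inv, abs_neg, abs_of_pos hlogpos]
  -- minimality of `ε₀`
  have hmin' : ∀ X Y : ℤ, 1 ≤ X → 1 ≤ Y →
      (X ^ 2 - (t₁ ^ 2 + 4 * m₁) * Y ^ 2 = 4 ∨ X ^ 2 - (t₁ ^ 2 + 4 * m₁) * Y ^ 2 = -4) →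
      ((t : ℝ) + u * s) / 2 ≤ (X + Y * Real.sqrt ((t₁ ^ 2 + 4 * m₁ : ℤ) : ℝ)) / 2 := by
    rw [hp']
    intro X Y hX hY hXY
    push_cast
    exact eps_le_of_sol hp1 htu hu hmin hX hY hXY
  -- the regulator and the class number formula
  have hreg := regulator_eq_log_of_minimal b hb h2 hd hω hε₀ hmin' ε hε
  have hCNF := LFunction_jacobiChar_one_eq_of_discr_pos h2 hodd hd
  have hlevel : (NumberField.discr K).natAbs = p := by rw [hdisc, Int.natAbs_natCast]
  rw [LFunction_jacobiChar_level_congr hlevel] at hCNF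
  rw [hCNF, torsionOrder_eq_two_of_discr_pos h2 hd, hreg, hdisc]
  push_cast
  rw [← hsdef]
  ring_nf

end UnitRegulator

/-! ## The transport to `ℤ[ζ_p]` and the proof of the congruence -/

section Final

open NumberField Polynomial

omit hp in
/-- If `s² = p` in `𝓞 L` and `t² + 4 = p u²`, then `(t + u s)/2 ∈ 𝓞 L` (a root of `X² - tX - 1`).
[folklore] -/
theorem exists_half {L : Type*} [Field L] [NumberField L] {t u : ℕ} (htu : t ^ 2 + 4 = p * u ^ 2)
    (s : 𝓞 L) (hs : s ^ 2 = p) : ∃ e : 𝓞 L, 2 * e = t + u * s := by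
  set x : L := ((t : L) + u * (s : L)) / 2 with hx
  have hsL : ((s : 𝓞 L) : L) ^ 2 = p := by
    have := congrArg (algebraMap (𝓞 L) L) hs
    simpa using this
  have htuL : (t : L) ^ 2 + 4 = p * u ^ 2 := by exact_mod_cast htu
  have hnum : ((t : L) + u * s) ^ 2 - 2 * t * ((t : L) + u * s) - 4 = 0 := by
    linear_combination (u : L) ^ 2 * hsL - htuL
  have hroot : x ^ 2 - t * x - 1 = 0 := by
    calc x ^ 2 - t * x - 1 = (((t : L) + u * s) ^ 2 - 2 * t * ((t : L) + u * s) - 4) / 4 := by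
          rw [hx]; ring
      _ = 0 := by rw [hnum, zero_div]
  have hint : IsIntegral ℤ x := by
    refine ⟨X ^ 2 - (C (t : ℤ) * X + C 1), ?_, ?_⟩
    · exact (monic_X_pow 2).sub_of_left (lt_of_le_of_lt degree_linear_le (by
        rw [degree_X_pow]; exact_mod_cast one_lt_two))
    · have : eval₂ (algebraMap ℤ L) x (X ^ 2 - (C (t : ℤ) * X + C 1)) = x ^ 2 - (t * x + 1) := by
        simp
      rw [this]
      linear_combination hroot
  refine ⟨⟨x, hint⟩, ?_⟩
  apply RingOfIntegers.coe_injective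
  simp only [map_mul, map_add, map_natCast, map_ofNat, RingOfIntegers.map_mk]
  rw [hx]
  ring

/-- **Chowla's congruence**, hypotheses unbundled, with the `p`-th cyclotomic field `L` and an
embedding `σ : L → ℂ` with `σ(ζ) = e^{2πi/p}` as parameters. [cite: Chowla1961, Theorem] -/
theorem chowla_aux_L {K : Type*} [Field K] [NumberField K] {L : Type*} [Field L] [NumberField L]
    [IsCyclotomicExtension {p} ℚ L] {ζ : L} (hζ : IsPrimitiveRoot ζ p) (σ : L →ₐ[ℚ] ℂ)
    (hσζ : σ ζ = Complex.exp (2 * Real.pi * Complex.I / p)) {t u : ℕ} (hp1 : p % 4 = 1)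
    (h2 : Module.finrank ℚ K = 2) (hdisc : NumberField.discr K = p) (htu : t ^ 2 + 4 = p * u ^ 2)
    (hu : 0 < u) (hmin : ∀ t' u' : ℕ, t' ^ 2 + 4 = p * u' ^ 2 → 0 < u' → t ≤ t') :
    (p : ℤ) ∣ 2 * (Nat.factorial ((p - 1) / 2) : ℤ) - (-1) ^ ((classNumber K + 1) / 2) * (t : ℤ) := by
  have hp2 := ne_two_of_mod_four_eq_one hp1
  have hprime := hp.out
  have hp5 : 5 ≤ p := by have := hprime.two_le; omega
  have hcards := card_qr_and_card_nr (p := p) hp2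
  set m := p / 2 with hm
  have hpm : (p - 1) / 2 = m := by omega
  have hmeven : Even m := ⟨p / 4, by omega⟩
  rw [hpm]
  set h := classNumber K with hh
  -- (F) + (E): the analytic dichotomy
  have hε₀pos : 0 < ((t : ℝ) + u * Real.sqrt p) / 2 := by
    have : 0 < Real.sqrt p := Real.sqrt_pos.mpr (by exact_mod_cast hprime.pos)
    have hu' : (0 : ℝ) < u := by exact_mod_cast hu
    positivity
  have hL := LFunction_one_eq_of_minimal hp1 h2 hdisc htu hu hmin
  have hE := analytic_dichotomy hp1 hε₀pos (h := h) hL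
  -- (L): the ring of integers of `L` and the map `φ : 𝓞 L → ℂ`
  set φ : 𝓞 L →+* ℂ := σ.toRingHom.comp (algebraMap (𝓞 L) L) with hφdef
  have hφinj : Function.Injective φ := σ.toRingHom.injective.comp RingOfIntegers.coe_injective
  set ζi : 𝓞 L := hζ.toInteger with hζidef
  have hφζ : φ ζi = Complex.exp (2 * Real.pi * Complex.I / p) := hσζ
  have hζi : IsPrimitiveRoot ζi p := hζ.toInteger_isPrimitiveRoot
  -- the Gauss sum and the two products in `𝓞 L`, and their images in `ℂ`
  set τi : 𝓞 L := ∑ j : ZMod p, (quadraticChar (ZMod p) j : 𝓞 L) * ζi ^ j.val with hτi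
  set Ni : 𝓞 L := ∏ j ∈ univ.filter (fun j : ZMod p => quadraticChar (ZMod p) j = -1),
    (1 - ζi ^ j.val) with hNi
  set Qi : 𝓞 L := ∏ j ∈ univ.filter (fun j : ZMod p => quadraticChar (ZMod p) j = 1),
    (1 - ζi ^ j.val) with hQi
  have hφτ : φ τi = gaussSum (jacobiChar p) (ZMod.stdAddChar (N := p)) := by
    rw [hτi, map_sum, gaussSum]
    refine Finset.sum_congr rfl fun j _ => ?_
    rw [map_mul, map_pow, hφζ, map_intCast, jacobiChar_eq_quadraticChar, stdAddChar_eq_pow]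
  have hφN : φ Ni = ∏ j ∈ univ.filter (fun j : ZMod p => quadraticChar (ZMod p) j = -1),
      (1 - Complex.exp (2 * Real.pi * Complex.I / p) ^ j.val) := by
    rw [hNi, map_prod]
    exact Finset.prod_congr rfl fun j _ => by rw [map_sub, map_one, map_pow, hφζ]
  have hφQ : φ Qi = ∏ j ∈ univ.filter (fun j : ZMod p => quadraticChar (ZMod p) j = 1),
      (1 - Complex.exp (2 * Real.pi * Complex.I / p) ^ j.val) := by
    rw [hQi, map_prod]
    exact Finset.prod_congr rfl fun j _ => by rw [map_sub, map_one, map_pow, hφζ]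
  have hτsq : τi ^ 2 = p := hφinj (by rw [map_pow, hφτ, gaussSum_sq_eq hp1, map_natCast])
  -- `1 - ζ ≠ 0`, `p ∈ (1 - ζ)^{p-1}`
  have hlam : (1 : 𝓞 L) - ζi ≠ 0 := sub_ne_zero.mpr (Ne.symm (hζi.ne_one hprime.one_lt))
  obtain ⟨G₀, hG₀, -⟩ := prod_one_sub_pow_eq ζi ((univ : Finset (ZMod p)).filter (· ≠ 0))
    (fun j => j.val)
  rw [prod_one_sub_pow_eq_prime hζi] at hG₀
  have hcard0 : ((univ : Finset (ZMod p)).filter (· ≠ 0)).card = p - 1 := by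
    rw [Finset.filter_ne' univ (0 : ZMod p), Finset.card_erase_of_mem (Finset.mem_univ _),
      Finset.card_univ, ZMod.card]
  rw [hcard0] at hG₀
  have hpmem1 : ((p : ℕ) : 𝓞 L) ∈ Ideal.span {(1 - ζi) ^ (m + 1)} := by
    rw [Ideal.mem_span_singleton]
    refine ⟨(1 - ζi) ^ (p - 1 - (m + 1)) * G₀, ?_⟩
    rw [hG₀, ← mul_assoc, ← pow_add, show m + 1 + (p - 1 - (m + 1)) = p - 1 by omega]
  have hpmem : ((p : ℕ) : 𝓞 L) ∈ Ideal.span {1 - ζi} := by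
    rw [Ideal.mem_span_singleton]
    refine ⟨(1 - ζi) ^ (p - 2) * G₀, ?_⟩
    rw [hG₀, ← mul_assoc, ← pow_succ', show p - 2 + 1 = p - 1 by omega]
  -- `m! τ ≡ -(1-ζ)^m  (mod (1-ζ)^{m+1})`
  have hτcong : (m.factorial : 𝓞 L) * τi + (1 - ζi) ^ m ∈ Ideal.span {(1 - ζi) ^ (m + 1)} := by
    have e1 : (ζi - 1) ^ m = (1 - ζi) ^ m := by rw [← neg_sub ζi 1, hmeven.neg_pow]
    have e2 : Ideal.span {(ζi - 1) ^ (m + 1)} = Ideal.span {(1 - ζi) ^ (m + 1)} := by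
      rw [← neg_sub ζi 1, hmeven.add_one.neg_pow, Ideal.span_singleton_neg]
    have h := factorial_mul_gaussSum_add_mem hp2 ζi (A := 𝓞 L) (by rw [e2]; exact hpmem1)
    rwa [e1, e2] at h
  -- `τ ∈ (1 - ζ)`
  have hτmem : τi ∈ Ideal.span {1 - ζi} := by
    have h0 : ∑ j : ZMod p, (quadraticChar (ZMod p) j : 𝓞 L) = 0 := by
      rw [← Int.cast_sum, quadraticChar_sum_zero (ringChar_ne_two hp2), Int.cast_zero]
    have e : τi = ∑ j : ZMod p, (quadraticChar (ZMod p) j : 𝓞 L) * (ζi ^ j.val - 1) := by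
      rw [hτi, ← sub_zero (∑ j : ZMod p, (quadraticChar (ZMod p) j : 𝓞 L) * ζi ^ j.val), ← h0,
        ← Finset.sum_sub_distrib]
      exact Finset.sum_congr rfl fun j _ => by ring
    rw [e]
    refine Ideal.sum_mem _ fun j _ => Ideal.mul_mem_left _ _ ?_
    rw [Ideal.mem_span_singleton,
      show ζi ^ j.val - 1 = -((1 - ζi) * ∑ i ∈ range j.val, ζi ^ i) by
        rw [← one_sub_pow_eq_mul_geom_sum]; ring]
    exact dvd_neg.mpr (dvd_mul_right _ _)
  -- congruences of the integer products
  have hNR1 : (((∏ j ∈ univ.filter (fun j : ZMod p => quadraticChar (ZMod p) j = -1), j.val : ℕ)) :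
      𝓞 L) - 1 ∈ Ideal.span {1 - ζi} := by
    have h1 : (p : ℤ) ∣ ((∏ j ∈ univ.filter (fun j : ZMod p => quadraticChar (ZMod p) j = -1),
        j.val : ℕ) : ℤ) - 1 := by
      rw [← ZMod.intCast_zmod_eq_zero_iff_dvd]
      push_cast
      simp_rw [ZMod.natCast_zmod_val]
      rw [prod_nr_id hp1, sub_self]
    obtain ⟨c, hc⟩ := h1
    have hc' := congrArg (fun z : ℤ => (z : 𝓞 L)) hc
    simp only [Int.cast_sub, Int.cast_natCast, Int.cast_one, Int.cast_mul] at hc'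
    rw [hc']
    exact Ideal.mul_mem_right _ _ hpmem
  have hQR1 : (((∏ j ∈ univ.filter (fun j : ZMod p => quadraticChar (ZMod p) j = 1), j.val : ℕ)) :
      𝓞 L) + 1 ∈ Ideal.span {1 - ζi} := by
    have h1 : (p : ℤ) ∣ ((∏ j ∈ univ.filter (fun j : ZMod p => quadraticChar (ZMod p) j = 1),
        j.val : ℕ) : ℤ) + 1 := by
      rw [← ZMod.intCast_zmod_eq_zero_iff_dvd]
      push_cast
      simp_rw [ZMod.natCast_zmod_val]
      rw [prod_qr_id hp1, neg_add_cancel]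
    obtain ⟨c, hc⟩ := h1
    have hc' := congrArg (fun z : ℤ => (z : 𝓞 L)) hc
    simp only [Int.cast_add, Int.cast_natCast, Int.cast_one, Int.cast_mul] at hc'
    rw [hc']
    exact Ideal.mul_mem_right _ _ hpmem
  have hcards := card_qr_and_card_nr (p := p) hp2
  -- the image of `(t + u s)/2`
  have hφhalf : ∀ (si εi : 𝓞 L), 2 * εi = t + u * si → φ si = (Real.sqrt p : ℂ) →
      φ εi = ((((t : ℝ) + u * Real.sqrt p) / 2 : ℝ) : ℂ) := by
    intro si εi hεi hsi
    have e := congrArg φ hεi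
    rw [map_mul, map_add, map_mul, map_natCast, map_natCast, map_ofNat, hsi] at e
    push_cast
    linear_combination e / 2
  -- the key data `P = τ ε^h = (1-ζ)^m G`, by cases on the sign of the Gauss sum
  obtain ⟨P, G, εi, hP, hPG, hG, hε⟩ : ∃ P G εi : 𝓞 L, P = τi * εi ^ h ∧ P = (1 - ζi) ^ m * G ∧
      G - 1 ∈ Ideal.span {1 - ζi} ∧ 2 * εi - (t : 𝓞 L) ∈ Ideal.span {1 - ζi} := by
    rcases hE with ⟨hτ1, hN⟩ | ⟨hτ1, hQ⟩
    · -- `τ = √p`, `N = τ ε₀^h`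
      obtain ⟨εi, hεi⟩ := exists_half htu τi hτsq
      have hφε := hφhalf τi εi hεi (by rw [hφτ, hτ1])
      obtain ⟨GN, hGN, hGNc⟩ := prod_one_sub_pow_eq ζi
        (univ.filter fun j : ZMod p => quadraticChar (ZMod p) j = -1) (fun j => j.val)
      refine ⟨Ni, GN, εi, ?_, ?_, ?_, ?_⟩
      · apply hφinj
        rw [map_mul, map_pow, hφN, hφτ, hφε]
        exact hN
      · rw [hm, ← hcards.2]
        exact hGN
      · have : GN - 1 = (GN - ((∏ j ∈ univ.filter (fun j : ZMod p => quadraticChar (ZMod p) j = -1),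
            j.val : ℕ) : 𝓞 L)) + ((((∏ j ∈ univ.filter (fun j : ZMod p =>
              quadraticChar (ZMod p) j = -1), j.val : ℕ)) : 𝓞 L) - 1) := by ring
        rw [this]
        exact Ideal.add_mem _ hGNc hNR1
      · rw [show 2 * εi - (t : 𝓞 L) = u * τi by rw [hεi]; ring]
        exact Ideal.mul_mem_left _ _ hτmem
    · -- `τ = -√p`, `-Q = τ ε₀^h`
      have hτsq' : (-τi) ^ 2 = p := by rw [neg_sq]; exact hτsq
      obtain ⟨εi, hεi⟩ := exists_half htu (-τi) hτsq'
      have hφε := hφhalf (-τi) εi hεi (by rw [map_neg, hφτ, hτ1, neg_neg])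
      obtain ⟨GQ, hGQ, hGQc⟩ := prod_one_sub_pow_eq ζi
        (univ.filter fun j : ZMod p => quadraticChar (ZMod p) j = 1) (fun j => j.val)
      refine ⟨-Qi, -GQ, εi, ?_, ?_, ?_, ?_⟩
      · apply hφinj
        rw [map_neg, map_mul, map_pow, hφQ, hφτ, hφε]
        exact hQ
      · rw [hm, ← hcards.1, mul_neg, ← hGQ]
      · have : -GQ - 1 = -(GQ - ((∏ j ∈ univ.filter (fun j : ZMod p => quadraticChar (ZMod p) j = 1),
            j.val : ℕ) : 𝓞 L)) - ((((∏ j ∈ univ.filter (fun j : ZMod p =>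
              quadraticChar (ZMod p) j = 1), j.val : ℕ)) : 𝓞 L) + 1) := by ring
        rw [this]
        exact Ideal.sub_mem _ (Submodule.neg_mem _ hGQc) hQR1
      · rw [show 2 * εi - (t : 𝓞 L) = -(u * τi) by rw [hεi]; ring]
        exact Submodule.neg_mem _ (Ideal.mul_mem_left _ _ hτmem)
  -- the key congruence, back to `ℤ`
  have hkey := key_congruence (t := (t : ℤ)) hlam hP hPG hG hτcong (by push_cast; exact hε)
  have hdiv : (p : ℤ) ∣ 2 ^ h * (m.factorial : ℤ) + (t : ℤ) ^ h :=
    int_dvd_of_mem_span_one_sub_zeta hζ hkey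
  have ht4 : (p : ℤ) ∣ (t : ℤ) ^ 2 + 4 := ⟨(u : ℤ) ^ 2, by exact_mod_cast htu⟩
  exact final_int_step hp1 ht4 h hdiv

/-- **Chowla's congruence**, hypotheses unbundled. [cite: Chowla1961, Theorem] -/
theorem chowla_aux {K : Type*} [Field K] [NumberField K] {t u : ℕ} (hp1 : p % 4 = 1)
    (h2 : Module.finrank ℚ K = 2) (hdisc : NumberField.discr K = p) (htu : t ^ 2 + 4 = p * u ^ 2)
    (hu : 0 < u) (hmin : ∀ t' u' : ℕ, t' ^ 2 + 4 = p * u' ^ 2 → 0 < u' → t ≤ t') :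
    (p : ℤ) ∣ 2 * (Nat.factorial ((p - 1) / 2) : ℤ) - (-1) ^ ((classNumber K + 1) / 2) * (t : ℤ) := by
  have hprime := hp.out
  haveI : NeZero p := ⟨hprime.ne_zero⟩
  -- (the instance is keyed on `CyclotomicField.algebra`, the goal on `DivisionRing.toRatAlgebra`)
  haveI : IsCyclotomicExtension {p} ℚ (CyclotomicField p ℚ) :=
    CyclotomicField.instIsCyclotomicExtensionSingletonNatSetOfCharZero p ℚ
  haveI : NumberField (CyclotomicField p ℚ) :=
    IsCyclotomicExtension.numberField {p} ℚ (CyclotomicField p ℚ)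
  have hζ := IsCyclotomicExtension.zeta_spec p ℚ (CyclotomicField p ℚ)
  have hirr : Irreducible (cyclotomic p ℚ) := cyclotomic.irreducible_rat hprime.pos
  have hmemC : Complex.exp (2 * Real.pi * Complex.I / p) ∈ primitiveRoots p ℂ :=
    (mem_primitiveRoots hprime.pos).mpr isPrimitiveRoot_zetaC
  obtain ⟨σ, hσζ⟩ : ∃ σ : CyclotomicField p ℚ →ₐ[ℚ] ℂ,
      σ (IsCyclotomicExtension.zeta p ℚ (CyclotomicField p ℚ)) =
        Complex.exp (2 * Real.pi * Complex.I / p) := by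
    refine ⟨(hζ.embeddingsEquivPrimitiveRoots ℂ hirr).symm ⟨_, hmemC⟩, ?_⟩
    have e := hζ.embeddingsEquivPrimitiveRoots_apply_coe ℂ hirr
      ((hζ.embeddingsEquivPrimitiveRoots ℂ hirr).symm ⟨_, hmemC⟩)
    rw [Equiv.apply_symm_apply] at e
    exact e.symm
  exact chowla_aux_L hζ σ hσζ hp1 h2 hdisc htu hu hmin

end Final

end Literature.NumberTheory.QuadraticFields.ChowlaProof


namespace Literature.NumberTheory.QuadraticFields

/-- **Discharge of `chowla_central_factorial_congruence` (Chowla 1961; Kiselev 1948).** For a prime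
`p ≡ 1 (mod 4)`, a quadratic number field `K` of discriminant `p` with class number `h`, and `(t, u)`
the least positive solution of `t² + 4 = p u²`: `p ∣ 2·((p−1)/2)! − (−1)^{(h+1)/2}·t`. The proof is
Chowla's, as presented in Urbanowicz–Williams, *Congruences for L-Functions*, Ch. II §1.1 Theorem 9:
Dirichlet's class number formula in the form `√p·ε^h = ∏_{n non-residue} (1 − ζ^n)` (here up to the
sign of the Gauss sum, which cancels) reduced modulo `(1 − ζ)^{(p+1)/2}` in `ℤ[ζ_p]`; see the module
docstring and `ChowlaProof.chowla_aux_L`. [cite: Chowla1961, Theorem] -/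
theorem chowla_central_factorial_congruence_holds : chowla_central_factorial_congruence := by
  intro p K _ _ t u hprime hp1 h2 hdisc htu hu hmin
  haveI : Fact p.Prime := ⟨hprime⟩
  exact ChowlaProof.chowla_aux hp1 h2 hdisc htu hu hmin

end Literature.NumberTheory.QuadraticFields
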